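import Mathlib
import Literature.Combinatorics.Optimization.BlockwiseDenseInnerProduct
import Literature.Computability.Complexity.FourierDegreeAlgebra
import HarnessLib

/-!
# Kothari–Meka–Raghavendra 2017: Lemma 2.3 (§4.1, small non-negative rank ⇒ approximate conical junta) and
# Theorem 1.10 (§4, "Proof of Theorem 1.10") for the tree's literal gadget — PROVED from the rectangular
# decomposition Theorem 2.11, which is TYPED here as the one named fact

Source: P. K. Kothari, R. Meka, P. Raghavendra, *Approximating rectangles by juntas and weakly-exponential
lower bounds for LP relaxations of CSPs*, STOC 2017 / SIAM J. Comput. 51 (2022) = arXiv:1610.02704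
[KothariMekaRaghavendra2017]; held text `paper:arxiv-1610.02704` (arXiv source; §1.2 Def. 1.7, §2.1–2.3,
§4, §4.1, §5, §6.2 read first-hand 2026-08-28).

RESULT. `KothariMekaRaghavendra2017_thm110_of_thm211 : KothariMekaRaghavendra2017_thm211 →
KothariMekaRaghavendra2017_thm110`: the tree's named fact **Theorem 1.10** (`LPRelaxationsMaxCSP.lean`:
"`nnr(M_f^b) ≥ 2^{c·b·(deg_+(f+η) − 8 deg f)}` for `b ≥ C log n`", from which Theorem 1.2 and Corollary 1.5
are already PROVED in the tree) follows from **Theorem 2.11** (= Theorem 6.4 for product densities: every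
product of two probability vectors on `([2^b])ⁿ` of min-entropy deficiency `t` is a convex combination of
products of aligned `d`-CBD probability vectors plus an error of weight `≤ 2^t (d q^{−0.05})^d`), typed below
as `KothariMekaRaghavendra2017_thm211` in the vocabulary of `BlockwiseDenseInnerProduct.lean`
(`HasAlignedDecomposition`). With `ApproximateConicalJuntas.lean` (Lemma 2.4, PROVED) and
`BlockwiseDenseInnerProduct.lean` (§5: Lemmas 5.1/5.3 and Theorem 5.5 from a decomposition, PROVED) this
file completes the printed architecture "Theorem 1.10 = Lemma 2.3 + Lemma 2.4" (§4, first paragraph) down to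
the single combinatorial statement Theorem 2.11, whose proof is the decomposition ALGORITHM of §6.3–6.4
(Lemmas 6.5–6.9) and is NOT formalised here. Constants obtained: `c = 1/2000`, `C = 1000` (the paper:
"`C ≥ max(16α_1, 1000)`", `c = Ω(1)` unprinted).

THE PRINTED ARGUMENT (§4.1, "Proof of Lemma 2.3", and §4, "Proof of Theorem 1.10"), and what replaces what.
* "From the definition of non-negative rank … `M_f = Σ_{i=1}^R λ_i u_i v_i†` [densities `u_i, v_i`,
  `λ_i ≥ 0`] … `Σ λ_i = E[M_f] = 1` … `f(z) = E_{(X,Y)∈G^{−1}(z)}[M_f(X,Y)] = Σ_i λ_i Acc_{u_i,v_i}(z)`."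
  — `rowMass/colMass/rectWeight/rowDensity/colDensity` and `sum_rectWeight_mul_ipOutputDensity`
  (`f·ν = Σ_l λ_l ν_{P_l,Q_l}`), `sum_rectWeight` (`Σ_l λ_l = m`).
* "large" rectangles (`H_∞(u_i) + H_∞(v_i) ≥ 2(n−t) log q`) "by Theorem 2.7 … `Acc_{u_i,v_i}` is an
  `(ε, ε^d)`-approximate conical `d`-junta … Therefore `J` is an `(ε,δ')`-approximate conical `d`-junta";
  "small" ones: "`λ_i u_i(x) ≤ E_y[M_f(x,y)] = E[f] = 1` … `λ_i ≤ 2^{−t/2}` … `E[δ_1] ≤ 2^{−t/2} R`" —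
  `rectWeight_mul_rowDensity_le`, `rectWeight_lt_of_small`, `isApproxConicalJunta_mixture`.
* "Proof of Theorem 1.10": Lemma 2.3 at `d = max{⌈α_1 log R/b⌉, deg f}`, then Lemma 2.4, then
  "`R ≥ 2^{Ω(b)·(deg_+(f+1/n) − 8 deg f)}`" — `nonnegDegree_add_inv_le_of_factorization` (with
  `t = 2 log₂ r + 16 d log₂ n + 8`, `d = max(deg f, ⌈(80 log₂ r + 480)/b⌉)`) and
  `KothariMekaRaghavendra2017_thm110_of_thm211` (degenerate cases `r = 0`, `n = 1`, `deg f = 0` settled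
  directly: `not_hasNonnegFactorization_zero`, `nonnegDegree_add_eq_zero_of_cubeDegree_eq_zero`).

A REPAIR, RECORDED (nothing in the typed statements changes). §1.2 says the gadget is "a slightly modified (in
order to ensure balancedness) version of the Boolean inner-product function", and §4.1 uses balancedness three
times ("`E[Acc] = E[u(x)v(y)] = 1`", "`𝟙_z` is a density", "`λ_i u_i(x) ≤ E_y M_f(x,y) = E[f] = 1`"). The
formula printed in Def. 1.7, `IP(x,y) = (−1)^{x_1⊕y_1}·(−1)^{⊕_{i=1}^b x_i y_i}` — typed literally as the
tree's `ipGadget` (the XOR bit is ALSO an inner-product bit) — equals `(x_1 ∨ y_1) ⊕ ⟨x', y'⟩` and is NOT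
balanced: `Σ_{y} (−1)^{IP(x,y)} = −2^b·[x = e_1]` (`sum_sgn_ipGadget`), so `P[IP = −1] = 1/2 − 2^{−(b+1)}`
and, worse, the row `x = e_1 = (1,0,…,0)` is constant. The printed proof is carried out here for the literal
gadget by replacing the uniform fibre weights with the uniform weights on `Kⁿ × Kⁿ`, `K = {0,1}^b ∖ {e_1}`:
on `K × K` the gadget is bi-regular (`Σ_{v∈K} (−1)^{IP(u,v)} = 1` for every `u ∈ K`,
`sum_regBlocks_sgn_ipGadget`), hence (i) the row sums `Σ_{y∈Kⁿ} M_f(x,y) = (2^b−1)ⁿ·m` are constant in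
`x ∈ Kⁿ` (`sum_regStrings_apply_ipMap`, `m = Σ_S f̂(S) κ^{|S|} = E[f ρ_κ]`, `κ = 1/(2^b−1)`), (ii) the
fibre density is the product weight `ρ_κ(z) = Π_i (1 + κ(−1)^{z_i})` (`regFibreDensity_eq_biasProd`), and
(iii) `f = ρ_κ^{−1}·Σ_l λ_l ν_{P_l,Q_l}` with `ρ_κ^{−1} = ρ_{−κ}/(1−κ²)ⁿ`; the reweighting by `ρ_{−κ}` keeps
"conjunction × (1 + decaying)" (`IsApproxConicalJunta.mul_biasProd`, file `ApproximateConicalJuntas.lean`)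
at the price of factors `(1 ± O(n/2^b))`, absorbed by Lemma 2.4 with the shift `1/(2n)`
(`isConicalJunta_add_of_isApproxConicalJunta`, same file). For `b ≥ 1000 log₂ n` all these factors lie in
`[9/10, 10/9]`. The min-entropy split is the printed one (threshold `2^t` on `(2^{bn} max P_l)(2^{bn} max Q_l)`),
with the honest Chor–Goldreich rate of `BlockwiseDenseInnerProduct.lean` (`ε = 2^{−0.3b}`, not `2^{−0.5b}`).

THE TYPED FACT (Theorem 2.11, §2.3, verbatim up to notation): "Let `X, Y` be two independent distributions
over `[q]ⁿ` with `H_∞(X) + H_∞(Y) ≥ 2n · log q − t`. Then `X × Y` can be written as a convex combination of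
distributions `X_1 × Y_1, …, X_N × Y_N, E` … `X × Y = Σ_{i} λ_i X_i × Y_i + λ_err E`, such that
`0 ≤ λ_i, λ_err ≤ 1`, `Σ λ_i + λ_err = 1`; `|λ_err| < 2^t (d q^{−0.05})^d`; for every `i`, `X_i, Y_i` are
aligned `d`-CBD distributions" (Def. 2.9: common fixed blocks `I`, `|I| ≤ d`, `H_∞ = 0` on them,
`H_∞(X_J) ≥ 0.8 log q |J|` off them). Typed with `q = 2^b`, the hypothesis exponentiated
(`(qⁿ P x)(qⁿ Q y) ≤ 2^t`), the conclusion as `HasAlignedDecomposition (2^{−0.8b}) (2^{−0.8b}) d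
(2^t (d 2^{−b/20})^d) P Q` (`λ_err ≤` in place of the printed `<`; `d` universally quantified as in Thm 6.4;
no `q ≥ n^c` — that hypothesis belongs to the `q^{−Ω(d)}` corollary Thm 2.10, whose printed side condition
"`d ≥ ct/(log q)`" should read "`d ≥ ct`" as its proof in §6.2 says, so Thm 2.10 is not the typed form).
Presearch (2026-08-28): tree — no decomposition of this kind (`rg blockwise|CBD` over `Literature/`: only this
story); corpus `lit search --hybrid "blockwise dense decomposition high min-entropy rectangles"` — nothing held
but the source; galaxy `"blockwise-dense|nonnegative juntas"` — the lifting papers it descends from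
(Göös–Lovett–Meka–Watson–Zuckerman 2015 "[GLMWZ15]", Göös–Jain–Watson 2016), no closer formal statement.

ALSO PROVED, of independent use: `one_add_pow_le_one_div` / `one_sub_mul_le_one_sub_pow` (Bernoulli in the
two forms used), `exists_ipMap_eq` (the gadget map is onto), the `Kⁿ` character sums
`sum_regStrings_walsh_ipMap`. One `set_option maxHeartbeats 400000 in` (the parameter bookkeeping of
`nonnegDegree_add_inv_le_of_factorization`). What this is NOT: not a proof of Theorem 2.11 / 6.4 (§6); hence
Theorem 1.10 stays a named fact, now PROVED MODULO `KothariMekaRaghavendra2017_thm211`; no P-vs-NP content.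
Consumer: cell pnp-psdrank (summit PneNP), row (5) of the literature-typing layer. No instances, no notation;
standard axioms.
-/

noncomputable section

open Finset
open Literature.Probability.RandomGraphs.LowDegree (walsh sgn walsh_empty sgn_true sgn_false)
open Literature.Computability.Complexity.LowDegree (cubeFourierCoeff sum_cubeFourierCoeff_mul_walsh
  cubeFourierCoeff_empty sum_walsh_mul_walsh_index)
open Literature.Computability.Complexity (ipSign ipSign_eq_walsh)

namespace Literature.Combinatorics.Optimization

variable {n b : ℕ}

/-! ### Theorem 2.11 (= Theorem 6.4 for product densities), TYPED as a named fact -/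

/-- **Kothari–Meka–Raghavendra 2017, Theorem 2.11 (rectangular decomposition of high-min-entropy product
distributions into aligned conjunctive-blockwise-dense pieces; = Theorem 6.4 for `μ = u ⊗ v`).** For all
`n, b` (`q = 2^b`), `t`, `d` and all probability vectors `P, Q` on `({0,1}^b)ⁿ` with
`H_∞(P) + H_∞(Q) ≥ 2n log q − t`, i.e. `(qⁿ P x)(qⁿ Q y) ≤ 2^t` for all `x, y`: `P ⊗ Q` is a convex
combination `Σ_i λ_i P_i ⊗ Q_i + λ_err E` of products of aligned `d`-CBD probability vectors (common fixed
blocks `I_i`, `|I_i| ≤ d`, point masses on the fixed blocks, block marginals off `I_i` of max-probability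
`≤ (q^{−0.8})^{|S|}`) and an error distribution `E`, with `λ_err ≤ 2^t (d q^{−0.05})^d` (printed: `<`).
NOT proved here (proof: the decomposition algorithm of §6.3 and its analysis §6.4, Lemmas 6.5–6.9).
[cite: KothariMekaRaghavendra2017, Thm 2.11 (§2.3) and Thm 6.4 with "Proof of Theorem 2.10" (§6.2)] -/
def KothariMekaRaghavendra2017_thm211 : Prop :=
  ∀ (n b : ℕ) (t : ℝ) (d : ℕ) (P Q : (Fin n → Fin b → Bool) → ℝ),
    (∀ x, 0 ≤ P x) → ∑ x, P x = 1 → (∀ y, 0 ≤ Q y) → ∑ y, Q y = 1 →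
    (∀ x y, ((2 : ℝ) ^ (b * n) * P x) * ((2 : ℝ) ^ (b * n) * Q y) ≤ (2 : ℝ) ^ t) →
    HasAlignedDecomposition ((2 : ℝ) ^ (-(4 / 5 : ℝ) * b)) ((2 : ℝ) ^ (-(4 / 5 : ℝ) * b)) d
      ((2 : ℝ) ^ t * ((d : ℝ) * (2 : ℝ) ^ (-(1 / 20 : ℝ) * b)) ^ d) P Q

/-- Unfolding lemma: the typed hypothesis and conclusion of `KothariMekaRaghavendra2017_thm211` at a given
pair `(P, Q)`. [cite: KothariMekaRaghavendra2017, Thm 2.11 (§2.3)] -/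
theorem KothariMekaRaghavendra2017_thm211.apply (h : KothariMekaRaghavendra2017_thm211) {n b : ℕ}
    {t : ℝ} (d : ℕ) {P Q : (Fin n → Fin b → Bool) → ℝ} (hP0 : ∀ x, 0 ≤ P x) (hP1 : ∑ x, P x = 1)
    (hQ0 : ∀ y, 0 ≤ Q y) (hQ1 : ∑ y, Q y = 1)
    (hH : ∀ x y, ((2 : ℝ) ^ (b * n) * P x) * ((2 : ℝ) ^ (b * n) * Q y) ≤ (2 : ℝ) ^ t) :
    HasAlignedDecomposition ((2 : ℝ) ^ (-(4 / 5 : ℝ) * b)) ((2 : ℝ) ^ (-(4 / 5 : ℝ) * b)) d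
      ((2 : ℝ) ^ t * ((d : ℝ) * (2 : ℝ) ^ (-(1 / 20 : ℝ) * b)) ^ d) P Q :=
  h n b t d P Q hP0 hP1 hQ0 hQ1 hH

/-- The trivial decomposition: every pair of probability vectors has an aligned decomposition with error
weight `1` (everything in the error term; `N = 0`).  In particular the typed conclusion of Theorem 2.11 holds
whenever its error bound is `≥ 1`, e.g. for `d = 0`. [cite: KothariMekaRaghavendra2017, Thm 2.11 (§2.3), degenerate case] -/
theorem hasAlignedDecomposition_of_one_le {n b : ℕ} (θ₁ θ₂ : ℝ) (d : ℕ) {δ : ℝ} (hδ : 1 ≤ δ)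
    {P Q : (Fin n → Fin b → Bool) → ℝ} (hP0 : ∀ x, 0 ≤ P x) (hP1 : ∑ x, P x = 1)
    (hQ0 : ∀ y, 0 ≤ Q y) (hQ1 : ∑ y, Q y = 1) : HasAlignedDecomposition θ₁ θ₂ d δ P Q := by
  refine ⟨0, Fin.elim0, Fin.elim0, Fin.elim0, Fin.elim0, Fin.elim0, Fin.elim0, 1, fun x y => P x * Q y,
    fun i => i.elim0, zero_le_one, by simp, hδ, fun i => i.elim0, fun i => i.elim0, fun i => i.elim0,
    fun i => i.elim0, fun i => i.elim0, fun i => i.elim0, fun i => i.elim0, fun i => i.elim0,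
    fun i => i.elim0, fun x y => mul_nonneg (hP0 x) (hQ0 y), ?_, fun x y => by simp⟩
  rw [← Finset.sum_mul_sum, hP1, hQ1, mul_one]


/-! ### The regular part of the literal gadget

The tree's `ipGadget b u v = (u₀ ⊕ v₀) ⊕ ⊕_{i} (u_i ∧ v_i)` (all `i`, including `i = 0`) equals
`(u₀ ∨ v₀) ⊕ ⟨u', v'⟩` and is not balanced; but on `K × K`, `K = {0,1}^b ∖ {e₁}` (`e₁ = (1,0,…,0)`), every
row and every column has the same sign sum `Σ_{v∈K} (−1)^{IP(u,v)} = 1` (`u ∈ K`), because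
`Σ_{v ∈ {0,1}^b} (−1)^{IP(u,v)} = −2^b·[u = e₁]` and `IP(u, e₁) = true` for every `u`. -/

/-- The block value `e₁ = (1,0,…,0) ∈ {0,1}^b`. [cite: KothariMekaRaghavendra2017, Def. 1.7 (the gadget; its exceptional row)] -/
def eOne (b : ℕ) : Fin b → Bool := fun i => decide (i.val = 0)

/-- The regular block values `K = {0,1}^b ∖ {e₁}`. [cite: KothariMekaRaghavendra2017, Def. 1.7 / §4.1] -/
def regBlocks (b : ℕ) : Finset (Fin b → Bool) := univ.erase (eOne b)

/-- The regular block strings `Kⁿ`. [cite: KothariMekaRaghavendra2017, §4.1] -/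
def regStrings (n b : ℕ) : Finset (Fin n → Fin b → Bool) := Fintype.piFinset fun _ => regBlocks b

/-- `|K| = 2^b − 1`. [cite: KothariMekaRaghavendra2017, §4.1] -/
theorem card_regBlocks (b : ℕ) : ((regBlocks b).card : ℝ) = 2 ^ b - 1 := by
  unfold regBlocks
  rw [Finset.card_erase_of_mem (mem_univ _), Finset.card_univ, Fintype.card_fun, Fintype.card_bool,
    Fintype.card_fin, Nat.cast_sub Nat.one_le_two_pow]
  push_cast
  ring

/-- `|Kⁿ| = (2^b − 1)ⁿ`. [cite: KothariMekaRaghavendra2017, §4.1] -/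
theorem card_regStrings (n b : ℕ) : ((regStrings n b).card : ℝ) = (2 ^ b - 1) ^ n := by
  unfold regStrings
  rw [Fintype.card_piFinset, Finset.prod_const, Finset.card_univ, Fintype.card_fin, Nat.cast_pow,
    card_regBlocks]

/-- Membership in `Kⁿ`. [cite: KothariMekaRaghavendra2017, §4.1] -/
theorem mem_regStrings {x : Fin n → Fin b → Bool} : x ∈ regStrings n b ↔ ∀ i, x i ≠ eOne b := by
  simp [regStrings, regBlocks, Fintype.mem_piFinset]

/-- `IP(u, e₁) = true` (`−1`) for every `u`. [cite: KothariMekaRaghavendra2017, Def. 1.7] -/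
theorem ipGadget_eOne (hb : 0 < b) (u : Fin b → Bool) : ipGadget b u (eOne b) = true := by
  unfold ipGadget
  rw [dif_pos hb]
  have h0 : eOne b ⟨0, hb⟩ = true := by simp [eOne]
  have hf : (univ.filter fun i : Fin b => (u i && eOne b i) = true) =
      (if u ⟨0, hb⟩ = true then {⟨0, hb⟩} else ∅) := by
    ext i
    simp only [mem_filter, mem_univ, true_and, eOne, Bool.and_eq_true, decide_eq_true_eq]
    have hi0 : i.val = 0 ↔ i = ⟨0, hb⟩ := by
      constructor
      · intro h; exact Fin.ext h
      · rintro rfl; rfl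
    rw [hi0]
    split_ifs with hu
    · simp only [mem_singleton]
      exact ⟨fun h => h.2, fun h => ⟨by rw [h]; exact hu, h⟩⟩
    · simp only [Finset.notMem_empty, iff_false, not_and]
      rintro h rfl
      exact hu h
  rw [hf, h0]
  cases hu : u ⟨0, hb⟩
  · simp
  · simp

/-- The full row sums of the literal gadget: `Σ_{v ∈ {0,1}^b} (−1)^{IP(u,v)} = −2^b [u = e₁]`.
[cite: KothariMekaRaghavendra2017, Def. 1.7 ("slightly modified (in order to ensure balancedness)")] -/
theorem sum_sgn_ipGadget (hb : 0 < b) (u : Fin b → Bool) :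
    ∑ v : Fin b → Bool, sgn (ipGadget b u v) = if u = eOne b then -(2 : ℝ) ^ b else 0 := by
  classical
  have hw : ∀ v : Fin b → Bool, sgn (v ⟨0, hb⟩) = walsh {⟨0, hb⟩} v := fun v => by
    simp [walsh]
  have key : ∀ v, sgn (ipGadget b u v) =
      sgn (u ⟨0, hb⟩) * (walsh {⟨0, hb⟩} v * walsh (univ.filter fun i => u i = true) v) := by
    intro v
    rw [sgn_ipGadget hb, ipSign_eq_walsh, hw v, mul_assoc]
  simp_rw [key]
  rw [← Finset.mul_sum, sum_walsh_mul_walsh_index]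
  have hiff : (({⟨0, hb⟩} : Finset (Fin b)) = univ.filter fun i => u i = true) ↔ u = eOne b := by
    constructor
    · intro h
      funext i
      have hi := congrArg (fun s : Finset (Fin b) => i ∈ s) h
      simp only [mem_singleton, mem_filter, mem_univ, true_and, eq_iff_iff] at hi
      unfold eOne
      by_cases hi0 : i = ⟨0, hb⟩
      · subst hi0
        rw [hi.1 rfl]; simp
      · have hui : u i = false := by
          cases h' : u i
          · rfl
          · exact absurd (hi.2 h') hi0
        rw [hui]
        have : ¬ i.val = 0 := fun h'' => hi0 (Fin.ext h'')
        simp [this]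
    · rintro rfl
      ext i
      simp only [mem_singleton, mem_filter, mem_univ, true_and, eOne, decide_eq_true_eq]
      constructor
      · rintro rfl; rfl
      · intro h; exact Fin.ext h
  by_cases hu : u = eOne b
  · rw [if_pos (hiff.2 hu), if_pos hu, hu]
    simp [eOne]
  · rw [if_neg (fun h => hu (hiff.1 h)), if_neg hu, mul_zero]

/-- **Regularity of the gadget on `K`:** `Σ_{v ∈ K} (−1)^{IP(u,v)} = 1` for every `u ∈ K`.
[cite: KothariMekaRaghavendra2017, §4.1 (repair of balancedness for the literal gadget)] -/
theorem sum_regBlocks_sgn_ipGadget (hb : 0 < b) {u : Fin b → Bool} (hu : u ≠ eOne b) :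
    ∑ v ∈ regBlocks b, sgn (ipGadget b u v) = 1 := by
  unfold regBlocks
  rw [Finset.sum_erase_eq_sub (mem_univ _), sum_sgn_ipGadget hb, if_neg hu, ipGadget_eOne hb]
  simp

/-- The gadget is symmetric. [cite: KothariMekaRaghavendra2017, Def. 1.7] -/
theorem ipGadget_comm (u v : Fin b → Bool) : ipGadget b u v = ipGadget b v u := by
  unfold ipGadget
  have : (univ.filter fun i => (u i && v i) = true) = univ.filter fun i => (v i && u i) = true := by
    ext i; simp [Bool.and_comm]
  rw [this]
  split_ifs
  · rw [Bool.xor_comm (u _) (v _)]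
  · rfl

/-- `G(x,y) = G(y,x)`. [cite: KothariMekaRaghavendra2017, Def. 1.7] -/
theorem ipMap_comm (x y : Fin n → Fin b → Bool) : ipMap b x y = ipMap b y x :=
  funext fun i => ipGadget_comm (x i) (y i)

/-- **Character sums over `Kⁿ`:** for `x ∈ Kⁿ`, `Σ_{y ∈ Kⁿ} χ_S(G(x,y)) = (2^b − 1)^{n − |S|}`.
[cite: KothariMekaRaghavendra2017, §4.1 (repair of "E_y M(x,y) = E f" for the literal gadget)] -/
theorem sum_regStrings_walsh_ipMap (hb : 0 < b) {x : Fin n → Fin b → Bool} (hx : x ∈ regStrings n b)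
    (S : Finset (Fin n)) :
    ∑ y ∈ regStrings n b, walsh S (ipMap b x y) = (2 ^ b - 1 : ℝ) ^ (n - S.card) := by
  classical
  have hx' := mem_regStrings.1 hx
  have e : ∀ y : Fin n → Fin b → Bool, walsh S (ipMap b x y) =
      ∏ i, (if i ∈ S then sgn (ipGadget b (x i) (y i)) else 1) := by
    intro y
    unfold walsh ipMap
    rw [Finset.prod_ite_mem, Finset.univ_inter]
  simp_rw [e]
  have hps := Finset.prod_univ_sum (fun _ : Fin n => regBlocks b)
    (fun i v => if i ∈ S then sgn (ipGadget b (x i) v) else (1 : ℝ))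
  rw [regStrings, ← hps]
  have fac : ∀ i, ∑ v ∈ regBlocks b, (if i ∈ S then sgn (ipGadget b (x i) v) else (1 : ℝ)) =
      if i ∈ S then (1 : ℝ) else (2 ^ b - 1 : ℝ) := by
    intro i
    split_ifs with hi
    · exact sum_regBlocks_sgn_ipGadget hb (hx' i)
    · rw [Finset.sum_const, nsmul_eq_mul, mul_one, card_regBlocks]
  simp_rw [fac]
  rw [Finset.prod_ite, Finset.prod_const_one, one_mul, Finset.prod_const]
  congr 1
  have e1 : univ.filter (fun i : Fin n => i ∈ S) = S := by ext i; simp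
  have := Finset.card_filter_add_card_filter_not (s := (univ : Finset (Fin n))) (fun i => i ∈ S)
  rw [e1, Finset.card_univ, Fintype.card_fin] at this
  omega

/-! ### From a non-negative factorisation to a mixture of gadget-output densities (§4.1, first half)

For `M_f^b = Σ_l U_l V_lᵀ` (`U, V ≥ 0`) put, with `K`-uniform weights: `s_l = Σ_{x∈Kⁿ} U_l(x)`,
`t_l = Σ_{y∈Kⁿ} V_l(y)`, `λ_l = s_l t_l/(2^b−1)^{2n}`, `P_l = 𝟙_{Kⁿ} U_l/s_l`, `Q_l = 𝟙_{Kⁿ} V_l/t_l`. Then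
`f(z)·ν(z) = Σ_l λ_l ν_{P_l,Q_l}(z)` with `ν = ρ_κ` the density of `G(X,Y)` for `X, Y` uniform on `Kⁿ`
(`κ = 1/(2^b−1)`), the row sums `Σ_{y∈Kⁿ} M(x,y) = (2^b−1)ⁿ m` are CONSTANT in `x ∈ Kⁿ`
(`m = Σ_S f̂(S) κ^{|S|} = E[f ρ_κ]`), whence `λ_l · 2^{bn} P_l(x) ≤ (2^b/(2^b−1))ⁿ m` (the printed
"`λ_i u_i(x) ≤ E_y M(x,y) = 1`"), and `Σ_l λ_l = m`. -/

section Mixture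

variable {r : ℕ} (U : (Fin n → Fin b → Bool) → Fin r → ℝ) (V : Fin r → (Fin n → Fin b → Bool) → ℝ)

/-- `s_l = Σ_{x ∈ Kⁿ} U_l(x)`. [cite: KothariMekaRaghavendra2017, §4.1 ("by appropriate normalization, M_i = λ_i u_i v_i†")] -/
def rowMass (l : Fin r) : ℝ := ∑ x ∈ regStrings n b, U x l

/-- `t_l = Σ_{y ∈ Kⁿ} V_l(y)`. [cite: KothariMekaRaghavendra2017, §4.1] -/
def colMass (l : Fin r) : ℝ := ∑ y ∈ regStrings n b, V l y

/-- `λ_l = s_l t_l/(2^b − 1)^{2n}`. [cite: KothariMekaRaghavendra2017, §4.1 ("λ_i")] -/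
def rectWeight (l : Fin r) : ℝ := rowMass U l * colMass V l / ((2 : ℝ) ^ b - 1) ^ (2 * n)

/-- `P_l = 𝟙_{Kⁿ} U_l / s_l` (a probability vector when `s_l ≠ 0`). [cite: KothariMekaRaghavendra2017, §4.1 ("u_i are densities")] -/
def rowDensity (l : Fin r) : (Fin n → Fin b → Bool) → ℝ :=
  fun x => if x ∈ regStrings n b then U x l / rowMass U l else 0

/-- `Q_l = 𝟙_{Kⁿ} V_l / t_l`. [cite: KothariMekaRaghavendra2017, §4.1 ("v_i are densities")] -/
def colDensity (l : Fin r) : (Fin n → Fin b → Bool) → ℝ :=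
  fun y => if y ∈ regStrings n b then V l y / colMass V l else 0

/-- The density `ν(z) = 2ⁿ Pr[G(X,Y) = z]` for `X, Y` independent uniform on `Kⁿ` (the analogue of the
printed "mean-one indicator `𝟙_z`"). [cite: KothariMekaRaghavendra2017, §4.1 (eq. for 𝟙_z) and §5 eq. (5.1)] -/
def regFibreDensity (n b : ℕ) : (Fin n → Bool) → ℝ :=
  fun z => (2 : ℝ) ^ n / ((2 : ℝ) ^ b - 1) ^ (2 * n) *
    ∑ x ∈ regStrings n b, ∑ y ∈ regStrings n b, if ipMap b x y = z then 1 else 0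

variable {U V}

/-- `s_l ≥ 0`. [cite: KothariMekaRaghavendra2017, §4.1] -/
theorem rowMass_nonneg (hU : ∀ x l, 0 ≤ U x l) (l : Fin r) : 0 ≤ rowMass (n := n) (b := b) U l :=
  sum_nonneg fun x _ => hU x l

/-- `t_l ≥ 0`. [cite: KothariMekaRaghavendra2017, §4.1] -/
theorem colMass_nonneg (hV : ∀ l y, 0 ≤ V l y) (l : Fin r) : 0 ≤ colMass (n := n) (b := b) V l :=
  sum_nonneg fun y _ => hV l y

/-- `λ_l ≥ 0`. [cite: KothariMekaRaghavendra2017, §4.1] -/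
theorem rectWeight_nonneg (hU : ∀ x l, 0 ≤ U x l) (hV : ∀ l y, 0 ≤ V l y) (l : Fin r) :
    0 ≤ rectWeight (n := n) U V l := by
  unfold rectWeight
  have h1 : (1 : ℝ) ≤ 2 ^ b := one_le_pow₀ (by norm_num)
  exact div_nonneg (mul_nonneg (rowMass_nonneg hU l) (colMass_nonneg hV l)) (pow_nonneg (by linarith) _)

/-- `P_l ≥ 0`. [cite: KothariMekaRaghavendra2017, §4.1] -/
theorem rowDensity_nonneg (hU : ∀ x l, 0 ≤ U x l) (l : Fin r) (x : Fin n → Fin b → Bool) :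
    0 ≤ rowDensity U l x := by
  unfold rowDensity
  split_ifs
  · exact div_nonneg (hU x l) (rowMass_nonneg hU l)
  · exact le_rfl

/-- `Q_l ≥ 0`. [cite: KothariMekaRaghavendra2017, §4.1] -/
theorem colDensity_nonneg (hV : ∀ l y, 0 ≤ V l y) (l : Fin r) (y : Fin n → Fin b → Bool) :
    0 ≤ colDensity V l y := by
  unfold colDensity
  split_ifs
  · exact div_nonneg (hV l y) (colMass_nonneg hV l)
  · exact le_rfl

/-- `Σ P_l = 1` when `s_l ≠ 0`. [cite: KothariMekaRaghavendra2017, §4.1] -/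
theorem sum_rowDensity {l : Fin r} (hs : rowMass (n := n) (b := b) U l ≠ 0) : ∑ x, rowDensity U l x = 1 := by
  unfold rowDensity
  rw [← Finset.sum_filter, Finset.filter_mem_eq_inter, Finset.univ_inter, ← Finset.sum_div]
  exact div_self hs

/-- `Σ Q_l = 1` when `t_l ≠ 0`. [cite: KothariMekaRaghavendra2017, §4.1] -/
theorem sum_colDensity {l : Fin r} (ht : colMass (n := n) (b := b) V l ≠ 0) : ∑ y, colDensity V l y = 1 := by
  unfold colDensity
  rw [← Finset.sum_filter, Finset.filter_mem_eq_inter, Finset.univ_inter, ← Finset.sum_div]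
  exact div_self ht

/-- `P_l` vanishes off `Kⁿ`. [cite: KothariMekaRaghavendra2017, §4.1] -/
theorem rowDensity_eq_zero {l : Fin r} {x : Fin n → Fin b → Bool} (hx : x ∉ regStrings n b) :
    rowDensity U l x = 0 := by
  unfold rowDensity; rw [if_neg hx]

/-- `Q_l` vanishes off `Kⁿ`. [cite: KothariMekaRaghavendra2017, §4.1] -/
theorem colDensity_eq_zero {l : Fin r} {y : Fin n → Fin b → Bool} (hy : y ∉ regStrings n b) :
    colDensity V l y = 0 := by
  unfold colDensity; rw [if_neg hy]

/-- The entrywise identity `λ_l P_l(x) Q_l(y) = 𝟙_{Kⁿ×Kⁿ}(x,y) U_l(x) V_l(y)/(2^b−1)^{2n}` (also when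
`s_l t_l = 0`, both sides vanishing). [cite: KothariMekaRaghavendra2017, §4.1 ("M_i = λ_i u_i v_i†")] -/
theorem rectWeight_mul_rowDensity_mul_colDensity (hU : ∀ x l, 0 ≤ U x l) (hV : ∀ l y, 0 ≤ V l y)
    (l : Fin r) (x y : Fin n → Fin b → Bool) :
    rectWeight U V l * (rowDensity U l x * colDensity V l y) =
      (if x ∈ regStrings n b ∧ y ∈ regStrings n b then U x l * V l y else 0) /
        ((2 : ℝ) ^ b - 1) ^ (2 * n) := by
  unfold rectWeight rowDensity colDensity
  by_cases hx : x ∈ regStrings n b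
  · by_cases hy : y ∈ regStrings n b
    · rw [if_pos hx, if_pos hy, if_pos ⟨hx, hy⟩]
      by_cases hs : rowMass U l = 0
      · have hUx : U x l = 0 :=
          (Finset.sum_eq_zero_iff_of_nonneg (fun x' _ => hU x' l)).1 hs x hx
        rw [hs, hUx]; simp
      by_cases ht : colMass V l = 0
      · have hVy : V l y = 0 :=
          (Finset.sum_eq_zero_iff_of_nonneg (fun y' _ => hV l y')).1 ht y hy
        rw [ht, hVy]; simp
      field_simp
    · rw [if_pos hx, if_neg hy, if_neg (show ¬ (x ∈ regStrings n b ∧ y ∈ regStrings n b) from fun h => hy h.2)]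
      simp
  · rw [if_neg hx, if_neg (show ¬ (x ∈ regStrings n b ∧ y ∈ regStrings n b) from fun h => hx h.1)]
    simp

/-- **`f·ν = Σ_l λ_l ν_{P_l,Q_l}`** (the printed "`f(z) = Σ_i λ_i Acc_{u_i,v_i}(z)`", with the fibre
density `ν = ρ_κ` of the literal gadget in place of `1`). [cite: KothariMekaRaghavendra2017, §4.1 (eq. "f(z) = Σ_{i=1}^R λ_i · Acc_{u_i,v_i}(z)")] -/
theorem sum_rectWeight_mul_ipOutputDensity {f : (Fin n → Bool) → ℝ}
    (hM : ∀ x y, f (ipMap b x y) = ∑ l, U x l * V l y) (hU : ∀ x l, 0 ≤ U x l) (hV : ∀ l y, 0 ≤ V l y)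
    (z : Fin n → Bool) :
    ∑ l, rectWeight U V l * ipOutputDensity (rowDensity U l) (colDensity V l) z =
      f z * regFibreDensity n b z := by
  classical
  set q : ℝ := ((2 : ℝ) ^ b - 1) ^ (2 * n) with hq
  -- the entrywise identity, summed over `l`, and the factorisation
  have h1 : ∀ x y : Fin n → Fin b → Bool, ∑ l, rectWeight U V l * (rowDensity U l x * colDensity V l y) =
      (if x ∈ regStrings n b ∧ y ∈ regStrings n b then f (ipMap b x y) else 0) / q := by
    intro x y
    simp_rw [rectWeight_mul_rowDensity_mul_colDensity hU hV]
    rw [← Finset.sum_div]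
    congr 1
    by_cases h : x ∈ regStrings n b ∧ y ∈ regStrings n b
    · simp only [if_pos h]; rw [hM]
    · simp only [if_neg h]; simp
  -- push `λ_l` inside and swap the sums
  have h2 : ∀ l, rectWeight U V l * ipOutputDensity (rowDensity U l) (colDensity V l) z =
      (2 : ℝ) ^ n * ∑ x, ∑ y, (if ipMap b x y = z then
        rectWeight U V l * (rowDensity U l x * colDensity V l y) else 0) := by
    intro l
    unfold ipOutputDensity
    rw [mul_left_comm, Finset.mul_sum]
    congr 1
    refine sum_congr rfl fun x _ => ?_
    rw [Finset.mul_sum]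
    refine sum_congr rfl fun y _ => ?_
    split_ifs <;> simp
  simp_rw [h2]
  rw [← Finset.mul_sum]
  have h3 : ∑ l, ∑ x, ∑ y, (if ipMap b x y = z then
      rectWeight U V l * (rowDensity U l x * colDensity V l y) else 0) =
      ∑ x, ∑ y, (if ipMap b x y = z then
        (if x ∈ regStrings n b ∧ y ∈ regStrings n b then f (ipMap b x y) else 0) / q else 0) := by
    rw [Finset.sum_comm]
    refine sum_congr rfl fun x _ => ?_
    rw [Finset.sum_comm]
    refine sum_congr rfl fun y _ => ?_
    by_cases hG : ipMap b x y = z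
    · simp only [if_pos hG, h1 x y]
    · simp only [if_neg hG, Finset.sum_const_zero]
  rw [h3]
  -- restrict to `Kⁿ × Kⁿ` and pull out `f z / q`
  have h4 : ∀ x y : Fin n → Fin b → Bool, (if ipMap b x y = z then
      (if x ∈ regStrings n b ∧ y ∈ regStrings n b then f (ipMap b x y) else 0) / q else 0) =
      if x ∈ regStrings n b then (if y ∈ regStrings n b then
        f z / q * (if ipMap b x y = z then 1 else 0) else 0) else 0 := by
    intro x y
    by_cases hx : x ∈ regStrings n b
    · by_cases hy : y ∈ regStrings n b
      · by_cases hG : ipMap b x y = z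
        · rw [if_pos hG, if_pos ⟨hx, hy⟩, if_pos hx, if_pos hy, if_pos hG, hG, mul_one]
        · rw [if_neg hG, if_pos hx, if_pos hy, if_neg hG, mul_zero]
      · rw [if_pos hx, if_neg hy,
          if_neg (show ¬ (x ∈ regStrings n b ∧ y ∈ regStrings n b) from fun h => hy h.2), zero_div]
        by_cases hG : ipMap b x y = z
        · rw [if_pos hG]
        · rw [if_neg hG]
    · rw [if_neg hx, if_neg (show ¬ (x ∈ regStrings n b ∧ y ∈ regStrings n b) from fun h => hx h.1),
        zero_div]
      by_cases hG : ipMap b x y = z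
      · rw [if_pos hG]
      · rw [if_neg hG]
  have h5 : ∀ x : Fin n → Fin b → Bool, ∑ y, (if x ∈ regStrings n b then (if y ∈ regStrings n b then
      f z / q * (if ipMap b x y = z then (1 : ℝ) else 0) else 0) else 0) =
      if x ∈ regStrings n b then f z / q * ∑ y ∈ regStrings n b, (if ipMap b x y = z then (1 : ℝ) else 0)
        else 0 := by
    intro x
    by_cases hx : x ∈ regStrings n b
    · simp only [if_pos hx]
      rw [← Finset.sum_filter, Finset.filter_mem_eq_inter, Finset.univ_inter, Finset.mul_sum]
    · simp only [if_neg hx, Finset.sum_const_zero]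
  simp_rw [h4, h5]
  rw [← Finset.sum_filter, Finset.filter_mem_eq_inter, Finset.univ_inter, ← Finset.mul_sum]
  unfold regFibreDensity
  rw [hq]
  ring

end Mixture

/-! ### The fibre density is the product weight `ρ_κ`; constant row sums; the weights `λ_l` -/

/-- `2^b − 1 ≥ 1` for `b ≥ 1`. [cite: KothariMekaRaghavendra2017, §1.2 (q = 2^b)] -/
theorem one_le_two_pow_sub_one (hb : 0 < b) : (1 : ℝ) ≤ 2 ^ b - 1 := by
  have : (2 : ℝ) ≤ 2 ^ b := by
    calc (2 : ℝ) = 2 ^ 1 := (pow_one _).symm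
      _ ≤ 2 ^ b := pow_le_pow_right₀ (by norm_num) hb
  linarith

/-- The "regular mean" `m = Σ_S f̂(S) κ^{|S|}`, `κ = 1/(2^b − 1)` (`= E[f ρ_κ]`, the common value of the
normalised row sums of `M_f^b` over `Kⁿ`). [cite: KothariMekaRaghavendra2017, §4.1 ("Σ λ_i = E[M_f] = 1", here for the literal gadget)] -/
def regMean (b : ℕ) (f : (Fin n → Bool) → ℝ) : ℝ :=
  ∑ S : Finset (Fin n), cubeFourierCoeff f S * (1 / ((2 : ℝ) ^ b - 1)) ^ S.card

/-- `m = E[f · ρ_κ]` (Plancherel). [cite: KothariMekaRaghavendra2017, §4.1] -/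
theorem regMean_eq_cubeExpect (f : (Fin n → Bool) → ℝ) :
    regMean b f = cubeExpect (fun z => f z * biasProd (1 / ((2 : ℝ) ^ b - 1)) z) := by
  rw [cubeExpect_mul_eq_sum_cubeFourierCoeff]
  unfold regMean
  exact sum_congr rfl fun S _ => by rw [cubeFourierCoeff_biasProd]

/-- Two-sided bounds `(1−κ)ⁿ E f ≤ m ≤ (1+κ)ⁿ E f` for `f ≥ 0` (`b ≥ 1`). [cite: KothariMekaRaghavendra2017, §4.1] -/
theorem regMean_le (hb : 0 < b) {f : (Fin n → Bool) → ℝ} (hf0 : ∀ z, 0 ≤ f z) :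
    regMean b f ≤ (1 + 1 / ((2 : ℝ) ^ b - 1)) ^ n * cubeExpect f := by
  rw [regMean_eq_cubeExpect, ← cubeExpect_const_mul]
  refine cubeExpect_mono fun z => ?_
  have h1 := one_le_two_pow_sub_one hb
  have hκ : |1 / ((2 : ℝ) ^ b - 1)| ≤ 1 := by
    rw [abs_of_nonneg (by positivity)]
    exact (div_le_one (by linarith)).2 h1
  have := biasProd_le hκ z
  rw [abs_of_nonneg (by positivity)] at this
  rw [mul_comm]
  exact mul_le_mul_of_nonneg_right this (hf0 z)

/-- The lower bound `(1−κ)ⁿ E f ≤ m` for `f ≥ 0` (`b ≥ 1`). [cite: KothariMekaRaghavendra2017, §4.1 ("Σ λ_i = E[M_f] = 1", for the literal gadget)] -/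
theorem le_regMean (hb : 0 < b) {f : (Fin n → Bool) → ℝ} (hf0 : ∀ z, 0 ≤ f z) :
    (1 - 1 / ((2 : ℝ) ^ b - 1)) ^ n * cubeExpect f ≤ regMean b f := by
  rw [regMean_eq_cubeExpect, ← cubeExpect_const_mul]
  refine cubeExpect_mono fun z => ?_
  have h1 := one_le_two_pow_sub_one hb
  have hκ : |1 / ((2 : ℝ) ^ b - 1)| ≤ 1 := by
    rw [abs_of_nonneg (by positivity)]
    exact (div_le_one (by linarith)).2 h1
  have := le_biasProd hκ z
  rw [abs_of_nonneg (by positivity)] at this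
  rw [mul_comm (f z)]
  exact mul_le_mul_of_nonneg_right this (hf0 z)

/-- **The fibre density of the literal gadget over `Kⁿ × Kⁿ` is the product weight `ρ_κ`**,
`κ = 1/(2^b − 1)` (comparison of Walsh coefficients: `ν̂(S) = κ^{|S|}` by the character sums over `Kⁿ`).
[cite: KothariMekaRaghavendra2017, §4.1 ("𝟙_z is a density", repaired)] -/
theorem regFibreDensity_eq_biasProd (hb : 0 < b) :
    regFibreDensity n b = biasProd (n := n) (1 / ((2 : ℝ) ^ b - 1)) := by
  classical
  set q1 : ℝ := (2 : ℝ) ^ b - 1 with hq1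
  have hq1pos : 0 < q1 := lt_of_lt_of_le one_pos (one_le_two_pow_sub_one hb)
  have hco : ∀ S : Finset (Fin n), cubeFourierCoeff (regFibreDensity n b) S = (1 / q1) ^ S.card := by
    intro S
    have hSn : S.card ≤ n := by simpa using S.card_le_univ
    unfold Literature.Computability.Complexity.LowDegree.cubeFourierCoeff
    have e1 : ∀ z : Fin n → Bool, regFibreDensity n b z * walsh S z =
        (2 : ℝ) ^ n / q1 ^ (2 * n) * ∑ x ∈ regStrings n b, ∑ y ∈ regStrings n b,
          (if ipMap b x y = z then walsh S z else 0) := by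
      intro z
      unfold regFibreDensity
      rw [mul_assoc, mul_comm (∑ x ∈ regStrings n b, _) (walsh S z), Finset.mul_sum]
      congr 1
      refine sum_congr rfl fun x _ => ?_
      rw [Finset.mul_sum]
      refine sum_congr rfl fun y _ => ?_
      split_ifs <;> simp
    simp_rw [e1]
    rw [← Finset.mul_sum, Finset.sum_comm]
    have e2 : ∀ x : Fin n → Fin b → Bool, ∑ z : Fin n → Bool, ∑ y ∈ regStrings n b,
        (if ipMap b x y = z then walsh S z else 0) = ∑ y ∈ regStrings n b, walsh S (ipMap b x y) := by
      intro x
      rw [Finset.sum_comm]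
      refine sum_congr rfl fun y _ => ?_
      rw [Finset.sum_ite_eq]; simp
    simp_rw [e2]
    rw [Finset.sum_congr rfl fun x hx => sum_regStrings_walsh_ipMap hb hx S, Finset.sum_const, nsmul_eq_mul,
      card_regStrings]
    rw [← hq1]
    have e3 : q1 ^ (2 * n) = q1 ^ n * q1 ^ (n - S.card) * q1 ^ S.card := by
      rw [← pow_add, ← pow_add]; congr 1; omega
    rw [e3, one_div_pow]
    field_simp
  funext z
  rw [← sum_cubeFourierCoeff_mul_walsh (regFibreDensity n b) z,
    ← sum_cubeFourierCoeff_mul_walsh (biasProd (1 / ((2 : ℝ) ^ b - 1))) z]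
  refine sum_congr rfl fun S _ => ?_
  rw [hco, cubeFourierCoeff_biasProd]

/-- **Constant row sums over `Kⁿ`:** `Σ_{y∈Kⁿ} f(G(x,y)) = (2^b−1)ⁿ m` for every `x ∈ Kⁿ` (the printed
"`E_y M_f(x,y) = E f`", repaired). [cite: KothariMekaRaghavendra2017, §4.1 ("λ_i u_i(x) ≤ E_y[M_f(x,y)] = E[f] = 1")] -/
theorem sum_regStrings_apply_ipMap (hb : 0 < b) (f : (Fin n → Bool) → ℝ) {x : Fin n → Fin b → Bool}
    (hx : x ∈ regStrings n b) :
    ∑ y ∈ regStrings n b, f (ipMap b x y) = ((2 : ℝ) ^ b - 1) ^ n * regMean b f := by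
  classical
  set q1 : ℝ := (2 : ℝ) ^ b - 1 with hq1
  have hq1pos : 0 < q1 := lt_of_lt_of_le one_pos (one_le_two_pow_sub_one hb)
  have e1 : ∀ y, f (ipMap b x y) = ∑ S, cubeFourierCoeff f S * walsh S (ipMap b x y) :=
    fun y => (sum_cubeFourierCoeff_mul_walsh f _).symm
  simp_rw [e1]
  rw [Finset.sum_comm]
  simp_rw [← Finset.mul_sum]
  rw [Finset.sum_congr rfl fun S _ => by rw [sum_regStrings_walsh_ipMap hb hx S]]
  unfold regMean
  rw [Finset.mul_sum]
  refine sum_congr rfl fun S _ => ?_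
  have hSn : S.card ≤ n := by simpa using S.card_le_univ
  rw [← hq1]
  have e3 : q1 ^ n = q1 ^ (n - S.card) * q1 ^ S.card := by
    rw [← pow_add]; congr 1; omega
  rw [e3, one_div_pow]
  field_simp

/-- Constant column sums over `Kⁿ` (the gadget is symmetric). [cite: KothariMekaRaghavendra2017, §4.1] -/
theorem sum_regStrings_apply_ipMap' (hb : 0 < b) (f : (Fin n → Bool) → ℝ) {y : Fin n → Fin b → Bool}
    (hy : y ∈ regStrings n b) :
    ∑ x ∈ regStrings n b, f (ipMap b x y) = ((2 : ℝ) ^ b - 1) ^ n * regMean b f := by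
  simp_rw [fun x => ipMap_comm (b := b) x y]
  exact sum_regStrings_apply_ipMap hb f hy

section Weights

variable {r : ℕ} {U : (Fin n → Fin b → Bool) → Fin r → ℝ} {V : Fin r → (Fin n → Fin b → Bool) → ℝ}
  {f : (Fin n → Bool) → ℝ}

/-- **`Σ_l λ_l = m`.** [cite: KothariMekaRaghavendra2017, §4.1 ("Σ_i λ_i = Σ_i λ_i E[u_i v_i†] = E[M_f] = 1")] -/
theorem sum_rectWeight (hb : 0 < b) (hM : ∀ x y, f (ipMap b x y) = ∑ l, U x l * V l y) :
    ∑ l, rectWeight U V l = regMean b f := by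
  classical
  set q1 : ℝ := (2 : ℝ) ^ b - 1 with hq1
  have hq1pos : 0 < q1 := lt_of_lt_of_le one_pos (one_le_two_pow_sub_one hb)
  unfold rectWeight rowMass colMass
  rw [← Finset.sum_div]
  simp_rw [Finset.sum_mul_sum]
  rw [Finset.sum_comm]
  simp_rw [Finset.sum_comm (s := univ) (t := regStrings n b)]
  simp_rw [← hM]
  rw [Finset.sum_congr rfl fun x hx => sum_regStrings_apply_ipMap hb f hx, Finset.sum_const, nsmul_eq_mul,
    card_regStrings, ← hq1]
  have e3 : q1 ^ (2 * n) = q1 ^ n * q1 ^ n := by rw [← pow_add]; ring_nf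
  rw [e3]
  field_simp

/-- **The weight bound** `λ_l P_l(x) ≤ m/(2^b−1)ⁿ` (the printed "`λ_i u_i(x) ≤ E_y M_f(x,y) = 1`").
[cite: KothariMekaRaghavendra2017, §4.1] -/
theorem rectWeight_mul_rowDensity_le (hb : 0 < b) (hM : ∀ x y, f (ipMap b x y) = ∑ l, U x l * V l y)
    (hU : ∀ x l, 0 ≤ U x l) (hV : ∀ l y, 0 ≤ V l y) (hf0 : ∀ z, 0 ≤ f z) (l : Fin r)
    (x : Fin n → Fin b → Bool) :
    rectWeight U V l * rowDensity U l x ≤ regMean b f / ((2 : ℝ) ^ b - 1) ^ n := by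
  classical
  set q1 : ℝ := (2 : ℝ) ^ b - 1 with hq1
  have hq1pos : 0 < q1 := lt_of_lt_of_le one_pos (one_le_two_pow_sub_one hb)
  have h1 := one_le_two_pow_sub_one hb
  have hκ1 : 1 / ((2 : ℝ) ^ b - 1) ≤ 1 := (div_le_one (by linarith)).2 h1
  have hm0 : 0 ≤ regMean b f :=
    le_trans (mul_nonneg (pow_nonneg (by linarith) _) (cubeExpect_nonneg hf0)) (le_regMean hb hf0)
  unfold rowDensity
  by_cases hx : x ∈ regStrings n b
  · rw [if_pos hx]
    by_cases hs : rowMass U l = 0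
    · rw [hs, div_zero, mul_zero]; positivity
    · -- `λ_l U_l(x)/s_l = t_l U_l(x)/q1^{2n} ≤ Σ_y M(x,y)/q1^{2n} = m/q1^n`
      have hspos : 0 < rowMass U l := lt_of_le_of_ne (rowMass_nonneg hU l) (Ne.symm hs)
      unfold rectWeight
      have hkey : colMass V l * U x l ≤ q1 ^ n * regMean b f := by
        calc colMass V l * U x l = ∑ y ∈ regStrings n b, U x l * V l y := by
              unfold colMass; rw [Finset.sum_mul]; exact sum_congr rfl fun y _ => by ring
          _ ≤ ∑ y ∈ regStrings n b, ∑ l', U x l' * V l' y :=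
              sum_le_sum fun y _ => Finset.single_le_sum (f := fun l' => U x l' * V l' y)
                (fun l' _ => mul_nonneg (hU x l') (hV l' y)) (mem_univ l)
          _ = ∑ y ∈ regStrings n b, f (ipMap b x y) := sum_congr rfl fun y _ => (hM x y).symm
          _ = q1 ^ n * regMean b f := sum_regStrings_apply_ipMap hb f hx
      rw [← hq1]
      have e3 : q1 ^ (2 * n) = q1 ^ n * q1 ^ n := by rw [← pow_add]; ring_nf
      rw [e3]
      rw [div_mul_div_comm, div_le_div_iff₀ (by positivity) (by positivity)]
      calc rowMass U l * colMass V l * U x l * q1 ^ n = rowMass U l * q1 ^ n * (colMass V l * U x l) := by ring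
        _ ≤ rowMass U l * q1 ^ n * (q1 ^ n * regMean b f) :=
            mul_le_mul_of_nonneg_left hkey (mul_nonneg (rowMass_nonneg hU l) (by positivity))
        _ = regMean b f * (q1 ^ n * q1 ^ n * rowMass U l) := by ring
  · rw [if_neg hx, mul_zero]; positivity

/-- The column version of the weight bound. [cite: KothariMekaRaghavendra2017, §4.1] -/
theorem rectWeight_mul_colDensity_le (hb : 0 < b) (hM : ∀ x y, f (ipMap b x y) = ∑ l, U x l * V l y)
    (hU : ∀ x l, 0 ≤ U x l) (hV : ∀ l y, 0 ≤ V l y) (hf0 : ∀ z, 0 ≤ f z) (l : Fin r)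
    (y : Fin n → Fin b → Bool) :
    rectWeight U V l * colDensity V l y ≤ regMean b f / ((2 : ℝ) ^ b - 1) ^ n := by
  classical
  set q1 : ℝ := (2 : ℝ) ^ b - 1 with hq1
  have hq1pos : 0 < q1 := lt_of_lt_of_le one_pos (one_le_two_pow_sub_one hb)
  have h1 := one_le_two_pow_sub_one hb
  have hκ1 : 1 / ((2 : ℝ) ^ b - 1) ≤ 1 := (div_le_one (by linarith)).2 h1
  have hm0 : 0 ≤ regMean b f :=
    le_trans (mul_nonneg (pow_nonneg (by linarith) _) (cubeExpect_nonneg hf0)) (le_regMean hb hf0)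
  unfold colDensity
  by_cases hy : y ∈ regStrings n b
  · rw [if_pos hy]
    by_cases ht : colMass V l = 0
    · rw [ht, div_zero, mul_zero]; positivity
    · have htpos : 0 < colMass V l := lt_of_le_of_ne (colMass_nonneg hV l) (Ne.symm ht)
      unfold rectWeight
      have hkey : rowMass U l * V l y ≤ q1 ^ n * regMean b f := by
        calc rowMass U l * V l y = ∑ x ∈ regStrings n b, U x l * V l y := by
              unfold rowMass; rw [Finset.sum_mul]
          _ ≤ ∑ x ∈ regStrings n b, ∑ l', U x l' * V l' y :=
              sum_le_sum fun x _ => Finset.single_le_sum (f := fun l' => U x l' * V l' y)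
                (fun l' _ => mul_nonneg (hU x l') (hV l' y)) (mem_univ l)
          _ = ∑ x ∈ regStrings n b, f (ipMap b x y) := sum_congr rfl fun x _ => (hM x y).symm
          _ = q1 ^ n * regMean b f := sum_regStrings_apply_ipMap' hb f hy
      rw [← hq1]
      have e3 : q1 ^ (2 * n) = q1 ^ n * q1 ^ n := by rw [← pow_add]; ring_nf
      rw [e3]
      rw [div_mul_div_comm, div_le_div_iff₀ (by positivity) (by positivity)]
      calc rowMass U l * colMass V l * V l y * q1 ^ n = colMass V l * q1 ^ n * (rowMass U l * V l y) := by ring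
        _ ≤ colMass V l * q1 ^ n * (q1 ^ n * regMean b f) :=
            mul_le_mul_of_nonneg_left hkey (mul_nonneg (colMass_nonneg hV l) (by positivity))
        _ = regMean b f * (q1 ^ n * q1 ^ n * colMass V l) := by ring
  · rw [if_neg hy, mul_zero]; positivity

end Weights

/-! ### Lemma 2.3 (§4.1) for the literal gadget: the mixture `(1/m) Σ_l λ_l ν_{P_l,Q_l}` is an
approximate conical junta (large rectangles by the decomposition hypothesis and Theorem 5.5, small
rectangles into the error), and `f/Λ = (mixture)·ρ_{−κ}/(1+τ)` is one too -/

section Assembly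

variable {r : ℕ} {U : (Fin n → Fin b → Bool) → Fin r → ℝ} {V : Fin r → (Fin n → Fin b → Bool) → ℝ}
  {f : (Fin n → Bool) → ℝ}

/-- `Σ_x P_l(x) ≤ 1` (it is `1` or `0`). [cite: KothariMekaRaghavendra2017, §4.1] -/
theorem sum_rowDensity_le_one (U : (Fin n → Fin b → Bool) → Fin r → ℝ) (l : Fin r) :
    ∑ x, rowDensity (n := n) (b := b) U l x ≤ 1 := by
  by_cases hs : rowMass U l = 0
  · have : ∀ x, rowDensity U l x = 0 := by
      intro x; unfold rowDensity; rw [hs]; simp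
    simp [this]
  · rw [sum_rowDensity hs]

/-- `Σ_y Q_l(y) ≤ 1`. [cite: KothariMekaRaghavendra2017, §4.1] -/
theorem sum_colDensity_le_one (V : Fin r → (Fin n → Fin b → Bool) → ℝ) (l : Fin r) :
    ∑ y, colDensity (n := n) (b := b) V l y ≤ 1 := by
  by_cases ht : colMass V l = 0
  · have : ∀ y, colDensity V l y = 0 := by
      intro y; unfold colDensity; rw [ht]; simp
    simp [this]
  · rw [sum_colDensity ht]

/-- `λ_l ≠ 0 ⇒ s_l ≠ 0 ∧ t_l ≠ 0`. [cite: KothariMekaRaghavendra2017, §4.1] -/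
theorem rowMass_ne_zero_of_rectWeight_ne_zero {l : Fin r} (h : rectWeight (n := n) (b := b) U V l ≠ 0) :
    rowMass U l ≠ 0 ∧ colMass V l ≠ 0 := by
  unfold rectWeight at h
  constructor
  · intro hs; apply h; rw [hs]; simp
  · intro ht; apply h; rw [ht]; simp

/-- The gadget-output density of a pair of non-negative vectors is non-negative. [cite: KothariMekaRaghavendra2017, §5 eq. (5.1)] -/
theorem ipOutputDensity_nonneg' {P Q : (Fin n → Fin b → Bool) → ℝ} (hP : ∀ x, 0 ≤ P x) (hQ : ∀ y, 0 ≤ Q y)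
    (z : Fin n → Bool) : 0 ≤ ipOutputDensity P Q z := by
  rw [← jointOutputDensity_mul]
  exact jointOutputDensity_nonneg (fun x y => mul_nonneg (hP x) (hQ y)) z

/-- `E[ν_{P,Q}] = (Σ P)(Σ Q)`. [cite: KothariMekaRaghavendra2017, §5 (Acc is a density)] -/
theorem cubeExpect_ipOutputDensity' (P Q : (Fin n → Fin b → Bool) → ℝ) :
    cubeExpect (ipOutputDensity P Q) = (∑ x, P x) * ∑ y, Q y := by
  rw [← jointOutputDensity_mul, cubeExpect_jointOutputDensity, Finset.sum_mul_sum]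

/-- A non-negative function is an `(ε, E g)`-approximate conical `d`-junta (everything in the error).
[cite: KothariMekaRaghavendra2017, Def. 2.2 (§2.1)] -/
theorem isApproxConicalJunta_of_nonneg {ε : ℝ} {d : ℕ} {g : (Fin n → Bool) → ℝ} (hg : ∀ z, 0 ≤ g z) :
    IsApproxConicalJunta ε (cubeExpect g) d g :=
  ⟨0, Fin.elim0, Fin.elim0, Fin.elim0, g, fun i => i.elim0, by simp, fun i => i.elim0, fun i => i.elim0, hg,
    le_rfl, fun z => by simp⟩

/-- **Small rectangles have small weight** (the printed "for any `i ∉ Q`, `λ_i ≤ 2^{−t/2}`", for the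
literal gadget: `λ_l < (2^b/(2^b−1))ⁿ · m · 2^{−t/2}` as soon as `(2^{bn}P_l(x))(2^{bn}Q_l(y)) > 2^t` for some
`x, y`). [cite: KothariMekaRaghavendra2017, §4.1 ("Observe that for any i ∉ Q, λ_i ≤ 2^{−t/2}")] -/
theorem rectWeight_lt_of_small (hb : 0 < b) (hM : ∀ x y, f (ipMap b x y) = ∑ l, U x l * V l y)
    (hU : ∀ x l, 0 ≤ U x l) (hV : ∀ l y, 0 ≤ V l y) (hf0 : ∀ z, 0 ≤ f z) (hm : 0 < regMean b f)
    {t : ℝ} {l : Fin r} {x y : Fin n → Fin b → Bool}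
    (hxy : (2 : ℝ) ^ t < ((2 : ℝ) ^ (b * n) * rowDensity U l x) * ((2 : ℝ) ^ (b * n) * colDensity V l y)) :
    rectWeight U V l < ((2 : ℝ) ^ b / (2 ^ b - 1)) ^ n * regMean b f * (2 : ℝ) ^ (-t / 2) := by
  set q1 : ℝ := (2 : ℝ) ^ b - 1 with hq1
  have hq1pos : 0 < q1 := lt_of_lt_of_le one_pos (one_le_two_pow_sub_one hb)
  set lam := rectWeight U V l with hlam
  have hlam0 : 0 ≤ lam := rectWeight_nonneg hU hV l
  set T : ℝ := (2 : ℝ) ^ (t / 2) with hT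
  have hTpos : 0 < T := Real.rpow_pos_of_pos (by norm_num) _
  have h2t : (2 : ℝ) ^ t = T * T := by rw [hT, ← Real.rpow_add (by norm_num)]; ring_nf
  have hneg : (2 : ℝ) ^ (-t / 2) = T⁻¹ := by
    rw [hT, ← Real.rpow_neg (by norm_num)]; ring_nf
  set B : ℝ := (2 : ℝ) ^ (b * n) * (regMean b f / q1 ^ n) with hB
  have hB0 : 0 ≤ B := by positivity
  have hgoal : ((2 : ℝ) ^ b / (2 ^ b - 1)) ^ n * regMean b f * (2 : ℝ) ^ (-t / 2) = B * T⁻¹ := by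
    rw [hneg, hB, ← hq1, div_pow, ← pow_mul]; ring
  rw [hgoal]
  rcases hlam0.eq_or_lt with h0 | hpos
  · rw [← h0]; exact mul_pos (by
      have : 0 < regMean b f / q1 ^ n := by positivity
      positivity) (inv_pos.2 hTpos)
  · -- `(λT)² = λ² 2^t < (2^{bn} λP)(2^{bn} λQ) ≤ B²`
    have hP := rectWeight_mul_rowDensity_le hb hM hU hV hf0 l x
    have hQ := rectWeight_mul_colDensity_le hb hM hU hV hf0 l y
    have hsq : (lam * T) ^ 2 < B ^ 2 := by
      have e1 : (lam * T) ^ 2 = lam * lam * (2 : ℝ) ^ t := by rw [h2t]; ring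
      have e2 : lam * lam * (((2 : ℝ) ^ (b * n) * rowDensity U l x) * ((2 : ℝ) ^ (b * n) * colDensity V l y)) =
          ((2 : ℝ) ^ (b * n) * (lam * rowDensity U l x)) * ((2 : ℝ) ^ (b * n) * (lam * colDensity V l y)) := by
        ring
      calc (lam * T) ^ 2 = lam * lam * (2 : ℝ) ^ t := e1
        _ < lam * lam * (((2 : ℝ) ^ (b * n) * rowDensity U l x) * ((2 : ℝ) ^ (b * n) * colDensity V l y)) :=
            mul_lt_mul_of_pos_left hxy (mul_pos hpos hpos)
        _ = ((2 : ℝ) ^ (b * n) * (lam * rowDensity U l x)) * ((2 : ℝ) ^ (b * n) * (lam * colDensity V l y)) := e2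
        _ ≤ B * B := by
            refine mul_le_mul ?_ ?_ (by
              exact mul_nonneg (by positivity) (mul_nonneg hlam0 (colDensity_nonneg hV l y))) hB0
            · exact mul_le_mul_of_nonneg_left hP (by positivity)
            · exact mul_le_mul_of_nonneg_left hQ (by positivity)
        _ = B ^ 2 := (sq B).symm
    have hlt : lam * T < B := lt_of_pow_lt_pow_left₀ 2 hB0 hsq
    rw [← div_eq_mul_inv, lt_div_iff₀ hTpos]
    exact hlt

/-- **Lemma 2.3 for the literal gadget, step 1 (the printed proof of §4.1):** the normalised mixture
`(1/m) Σ_l λ_l ν_{P_l,Q_l}` is an `(ε, δ₀ + r·(2^b/(2^b−1))ⁿ·2^{−t/2})`-approximate conical `d`-junta,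
GIVEN the decomposition (Theorem 2.11 at deficiency `t`, degree `d`, error `δ₀`) for every pair of
probability vectors: the "large" rectangles (`λ_l ≠ 0`, `H_∞(P_l)+H_∞(Q_l) ≥ 2bn − t`) are
`(ε,δ₀)`-approximate conical `d`-juntas by Theorem 5.5, the "small" ones have `λ_l < (2^b/(2^b−1))ⁿ m 2^{−t/2}`
and go into the additive error. [cite: KothariMekaRaghavendra2017, Lemma 2.3 with its proof (§4.1)] -/
theorem isApproxConicalJunta_mixture (hb : 0 < b) {θ ε : ℝ} (hθ : 0 ≤ θ) (hε0 : 0 ≤ ε)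
    (hθε : θ * θ * 2 ^ b ≤ ε ^ 2) {t : ℝ} {d : ℕ} {δ₀ : ℝ} (hδ₀ : 0 ≤ δ₀)
    (hdec : ∀ P Q : (Fin n → Fin b → Bool) → ℝ, (∀ x, 0 ≤ P x) → ∑ x, P x = 1 → (∀ y, 0 ≤ Q y) →
      ∑ y, Q y = 1 → (∀ x y, ((2 : ℝ) ^ (b * n) * P x) * ((2 : ℝ) ^ (b * n) * Q y) ≤ (2 : ℝ) ^ t) →
      HasAlignedDecomposition θ θ d δ₀ P Q)
    (hf0 : ∀ z, 0 ≤ f z) (hM : ∀ x y, f (ipMap b x y) = ∑ l, U x l * V l y)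
    (hU : ∀ x l, 0 ≤ U x l) (hV : ∀ l y, 0 ≤ V l y) (hm : 0 < regMean b f) :
    IsApproxConicalJunta ε (δ₀ + r * (((2 : ℝ) ^ b / (2 ^ b - 1)) ^ n * (2 : ℝ) ^ (-t / 2))) d
      (fun z => ∑ l, (rectWeight U V l / regMean b f) *
        ipOutputDensity (rowDensity U l) (colDensity V l) z) := by
  classical
  set m := regMean b f with hmdef
  set Γ : ℝ := ((2 : ℝ) ^ b / (2 ^ b - 1)) ^ n * (2 : ℝ) ^ (-t / 2) with hΓ
  have hΓ0 : 0 ≤ Γ := by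
    have h1 := one_le_two_pow_sub_one hb
    have : 0 ≤ (2 : ℝ) ^ (-t / 2) := Real.rpow_nonneg (by norm_num) _
    positivity
  -- large / small rectangles
  let large : Fin r → Prop := fun l => rectWeight U V l ≠ 0 ∧
    ∀ x y, ((2 : ℝ) ^ (b * n) * rowDensity U l x) * ((2 : ℝ) ^ (b * n) * colDensity V l y) ≤ (2 : ℝ) ^ t
  set A : Fin r → (Fin n → Bool) → ℝ := fun l => ipOutputDensity (rowDensity U l) (colDensity V l) with hAdef
  set δ : Fin r → ℝ := fun l => if large l then δ₀ else cubeExpect (A l) with hδdef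
  have hA : ∀ l, IsApproxConicalJunta ε (δ l) d (A l) := by
    intro l
    by_cases hl : large l
    · rw [hδdef]; simp only [if_pos hl]
      obtain ⟨hne, hH⟩ := hl
      obtain ⟨hs, ht⟩ := rowMass_ne_zero_of_rectWeight_ne_zero hne
      exact isApproxConicalJunta_ipOutputDensity_of_hasAlignedDecomposition hb hθ hθ hε0 hθε
        (hdec _ _ (rowDensity_nonneg hU l) (sum_rowDensity hs) (colDensity_nonneg hV l)
          (sum_colDensity ht) hH)
    · rw [hδdef]; simp only [if_neg hl]
      exact isApproxConicalJunta_of_nonneg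
        (ipOutputDensity_nonneg' (rowDensity_nonneg hU l) (colDensity_nonneg hV l))
  have hw0 : ∀ l, 0 ≤ rectWeight U V l / m := fun l => div_nonneg (rectWeight_nonneg hU hV l) hm.le
  have hw1' : ∑ l, rectWeight U V l / m = 1 := by
    rw [← Finset.sum_div, hmdef, sum_rectWeight hb hM, div_self hm.ne']
  have hmix := isApproxConicalJunta_sum hA hw0 hw1'.le
  refine hmix.mono hε0 le_rfl ?_
  -- the error budget
  have hsmall : ∀ l, ¬ large l → rectWeight U V l ≤ Γ * m := by
    intro l hl
    by_cases h0 : rectWeight U V l = 0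
    · rw [h0]; positivity
    · have hex : ∃ x y, ¬ (((2 : ℝ) ^ (b * n) * rowDensity U l x) *
          ((2 : ℝ) ^ (b * n) * colDensity V l y) ≤ (2 : ℝ) ^ t) := by
        by_contra hne
        apply hl
        refine ⟨h0, fun x y => ?_⟩
        by_contra hxy
        exact hne ⟨x, y, hxy⟩
      obtain ⟨x, y, hxy⟩ := hex
      have := rectWeight_lt_of_small hb hM hU hV hf0 hm (not_le.1 hxy)
      rw [hΓ]; linarith
  have hE1 : ∀ l, cubeExpect (A l) ≤ 1 := by
    intro l
    rw [hAdef]; simp only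
    rw [cubeExpect_ipOutputDensity']
    exact mul_le_one₀ (sum_rowDensity_le_one U l) (sum_nonneg fun y _ => colDensity_nonneg hV l y)
      (sum_colDensity_le_one V l)
  calc ∑ l, rectWeight U V l / m * δ l
      ≤ ∑ l, (rectWeight U V l / m * δ₀ + (if large l then 0 else Γ)) := by
        refine sum_le_sum fun l _ => ?_
        by_cases hl : large l
        · rw [hδdef]; simp only [if_pos hl]; linarith
        · rw [hδdef]; simp only [if_neg hl]
          have h1 : rectWeight U V l / m * cubeExpect (A l) ≤ rectWeight U V l / m :=
            mul_le_of_le_one_right (hw0 l) (hE1 l)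
          have h2 : rectWeight U V l / m ≤ Γ := by
            rw [div_le_iff₀ hm]; exact hsmall l hl
          have h3 : 0 ≤ rectWeight U V l / m * δ₀ := mul_nonneg (hw0 l) hδ₀
          linarith
    _ = (∑ l, rectWeight U V l / m) * δ₀ + ∑ l, (if large l then 0 else Γ) := by
        rw [Finset.sum_add_distrib, Finset.sum_mul]
    _ ≤ 1 * δ₀ + ∑ _l : Fin r, Γ := by
        rw [hw1']
        refine add_le_add le_rfl (sum_le_sum fun l _ => ?_)
        split_ifs
        · exact hΓ0
        · exact le_rfl
    _ = δ₀ + r * Γ := by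
        rw [Finset.sum_const, card_univ, Fintype.card_fin, nsmul_eq_mul, one_mul]

/-- **Lemma 2.3 for the literal gadget:** with `κ = 1/(2^b−1)`, `τ = (1+κε)ⁿ − 1 < 1` and
`Λ = m(1+τ)/(1−κ²)ⁿ`, the function `f/Λ` is an `(ε', (1+κ)ⁿ(δ₀ + r(2^b/(2^b−1))ⁿ2^{−t/2}))`-approximate
conical `d`-junta, `ε' = (κ+ε)(1+κε)ⁿ/(1−τ)` — from the mixture (`isApproxConicalJunta_mixture`), the identity
`f·ρ_κ = Σ_l λ_l ν_{P_l,Q_l}` and the reweighting by `ρ_{−κ}` (`IsApproxConicalJunta.mul_biasProd`,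
`ρ_κ ρ_{−κ} = (1−κ²)ⁿ`). [cite: KothariMekaRaghavendra2017, Lemma 2.3 (§2.1) with its proof (§4.1), literal gadget] -/
theorem isApproxConicalJunta_div_of_nonnegFactorization (hb : 2 ≤ b) {θ ε : ℝ} (hθ : 0 ≤ θ) (hε0 : 0 ≤ ε)
    (hθε : θ * θ * 2 ^ b ≤ ε ^ 2) {t : ℝ} {d : ℕ} {δ₀ : ℝ} (hδ₀ : 0 ≤ δ₀)
    (hdec : ∀ P Q : (Fin n → Fin b → Bool) → ℝ, (∀ x, 0 ≤ P x) → ∑ x, P x = 1 → (∀ y, 0 ≤ Q y) →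
      ∑ y, Q y = 1 → (∀ x y, ((2 : ℝ) ^ (b * n) * P x) * ((2 : ℝ) ^ (b * n) * Q y) ≤ (2 : ℝ) ^ t) →
      HasAlignedDecomposition θ θ d δ₀ P Q)
    (hf0 : ∀ z, 0 ≤ f z) (hM : ∀ x y, f (ipMap b x y) = ∑ l, U x l * V l y)
    (hU : ∀ x l, 0 ≤ U x l) (hV : ∀ l y, 0 ≤ V l y) (hm : 0 < regMean b f) {κ : ℝ}
    (hκ : κ = 1 / ((2 : ℝ) ^ b - 1)) (hτ : (1 + κ * ε) ^ n - 1 < 1) :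
    IsApproxConicalJunta ((κ + ε) * (1 + κ * ε) ^ n / (1 - ((1 + κ * ε) ^ n - 1)))
      ((1 + κ) ^ n * (δ₀ + r * (((2 : ℝ) ^ b / (2 ^ b - 1)) ^ n * (2 : ℝ) ^ (-t / 2)))) d
      (fun z => f z / (regMean b f * (1 + ((1 + κ * ε) ^ n - 1)) / (1 - κ ^ 2) ^ n)) := by
  classical
  have hb0 : 0 < b := by omega
  have h3 : (3 : ℝ) ≤ 2 ^ b - 1 := by
    have : (4 : ℝ) ≤ 2 ^ b := by
      calc (4 : ℝ) = 2 ^ 2 := by norm_num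
        _ ≤ 2 ^ b := pow_le_pow_right₀ (by norm_num) hb
    linarith
  have hκ0 : 0 ≤ κ := by rw [hκ]; positivity
  have hκ1 : κ < 1 := by
    rw [hκ, div_lt_one (by linarith)]; linarith
  have hG := isApproxConicalJunta_mixture hb0 hθ hε0 hθε hδ₀ hdec hf0 hM hU hV hm
  have hc : |-κ| ≤ κ := by rw [abs_neg, abs_of_nonneg hκ0]
  have hmb := hG.mul_biasProd hε0 hκ0 hκ1 hc hτ
  -- identify the function
  set τ : ℝ := (1 + κ * ε) ^ n - 1 with hτdef
  have hτ0 : 0 ≤ τ := by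
    rw [hτdef]; linarith [one_le_pow₀ (by nlinarith : (1 : ℝ) ≤ 1 + κ * ε) (n := n)]
  have hκ2 : 0 < (1 - κ ^ 2) ^ n := pow_pos (by nlinarith) n
  have hfun : (fun z => (∑ l, rectWeight U V l / regMean b f *
      ipOutputDensity (rowDensity U l) (colDensity V l) z) * biasProd (-κ) z / (1 + τ)) =
      fun z => f z / (regMean b f * (1 + τ) / (1 - κ ^ 2) ^ n) := by
    funext z
    have e1 : ∑ l, rectWeight U V l / regMean b f * ipOutputDensity (rowDensity U l) (colDensity V l) z =
        (∑ l, rectWeight U V l * ipOutputDensity (rowDensity U l) (colDensity V l) z) / regMean b f := by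
      rw [Finset.sum_div]
      exact sum_congr rfl fun l _ => by ring
    rw [e1, sum_rectWeight_mul_ipOutputDensity hM hU hV z, regFibreDensity_eq_biasProd hb0, ← hκ]
    have e2 := biasProd_mul_biasProd_neg κ z
    rw [div_mul_eq_mul_div, mul_assoc, e2]
    field_simp
  rw [hfun] at hmb
  exact hmb

end Assembly

/-! ### Elementary estimates for "Proof of Theorem 1.10" -/

/-- Bernoulli, upper form: `(1+x)ⁿ ≤ 1/(1 − nx)` for `0 ≤ x`, `nx < 1`. [cite: KothariMekaRaghavendra2017, §4 (proof of Thm 1.10: parameter bookkeeping)] -/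
theorem one_add_pow_le_one_div {x : ℝ} (hx : 0 ≤ x) (hnx : (n : ℝ) * x < 1) :
    (1 + x) ^ n ≤ 1 / (1 - n * x) := by
  rcases Nat.eq_zero_or_pos n with h0 | hpos
  · subst h0; simp
  have hx1 : x ≤ 1 := by
    have hn1 : (1 : ℝ) ≤ n := by exact_mod_cast hpos
    nlinarith
  rw [le_div_iff₀ (by linarith)]
  have hB : 1 - (n : ℝ) * x ≤ (1 - x) ^ n := by
    have := one_add_mul_le_pow (a := -x) (by linarith) n
    calc 1 - (n : ℝ) * x = 1 + n * (-x) := by ring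
      _ ≤ (1 + -x) ^ n := this
      _ = (1 - x) ^ n := by ring
  calc (1 + x) ^ n * (1 - n * x) ≤ (1 + x) ^ n * (1 - x) ^ n :=
        mul_le_mul_of_nonneg_left hB (by positivity)
    _ = (1 - x ^ 2) ^ n := by rw [← mul_pow]; ring
    _ ≤ 1 := pow_le_one₀ (by nlinarith) (by nlinarith)

/-- Bernoulli, lower form: `1 − nx ≤ (1 − x)ⁿ` for `0 ≤ x ≤ 2`. [cite: KothariMekaRaghavendra2017, §4] -/
theorem one_sub_mul_le_one_sub_pow {x : ℝ} (hx : x ≤ 2) : 1 - (n : ℝ) * x ≤ (1 - x) ^ n := by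
  have := one_add_mul_le_pow (a := -x) (by linarith) n
  calc 1 - (n : ℝ) * x = 1 + n * (-x) := by ring
    _ ≤ (1 + -x) ^ n := this
    _ = (1 - x) ^ n := by ring

/-- `nᵏ = 2^{k·log₂ n}` (`n > 0`). [cite: KothariMekaRaghavendra2017, §4 ("all logarithms are to the base 2")] -/
theorem pow_eq_two_rpow_mul_logb {x : ℝ} (hx : 0 < x) (k : ℕ) :
    x ^ k = (2 : ℝ) ^ (Real.logb 2 x * k) := by
  rw [Real.rpow_mul_natCast (by norm_num), Real.rpow_logb (by norm_num) (by norm_num) hx]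

/-- The gadget map is onto: every `z` is `G(0, y)` with `y_i ∈ {0, e₁}`. [cite: KothariMekaRaghavendra2017, Def. 1.7] -/
theorem exists_ipMap_eq (hb : 0 < b) (z : Fin n → Bool) : ∃ x y : Fin n → Fin b → Bool, ipMap b x y = z := by
  refine ⟨fun _ _ => false, fun i => if z i then eOne b else fun _ => false, funext fun i => ?_⟩
  unfold ipMap
  show ipGadget b (fun _ => false) (if z i = true then eOne b else fun _ => false) = z i
  by_cases hz : z i = true
  · rw [if_pos hz, ipGadget_eOne hb, hz]
  · rw [if_neg hz]
    have : ipGadget b (fun _ => false) (fun _ => false) = false := by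
      unfold ipGadget; rw [dif_pos hb]; simp
    rw [this]
    cases h : z i
    · rfl
    · exact absurd h hz

/-- A degree-`0` non-negative `f` has `deg_+(f + η) = 0` for `η ≥ 0`. [cite: KothariMekaRaghavendra2017, Def. 1.9 / Thm 1.10] -/
theorem nonnegDegree_add_eq_zero_of_cubeDegree_eq_zero {f : (Fin n → Bool) → ℝ} (hf0 : ∀ z, 0 ≤ f z)
    (hdeg : cubeDegree f = 0) {η : ℝ} (hη : 0 ≤ η) : nonnegDegree (fun z => f z + η) = 0 := by
  have hd : HasDegreeLE 0 f := (cubeDegree_le_iff f 0).1 (le_of_eq hdeg)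
  have hconst : (fun z => f z + η) = fun _ => cubeFourierCoeff f ∅ + η :=
    funext fun z => by rw [eq_const_of_hasDegreeLE_zero hd z]
  have h0 : 0 ≤ cubeFourierCoeff f ∅ + η := by
    have := hf0 (fun _ => false)
    rw [eq_const_of_hasDegreeLE_zero hd] at this
    linarith
  rw [hconst]
  exact Nat.le_zero.1 ((isConicalJunta_iff_nonnegDegree_le fun _ => h0).1 (isConicalJunta_const_of_nonneg 0 h0))

/-- A size-`0` factorisation of `M_f^b` forces `f = 0` (the gadget map is onto), impossible for `E f = 1`.
[cite: KothariMekaRaghavendra2017, Thm 1.10 (nnr ≥ 1)] -/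
theorem not_hasNonnegFactorization_zero (hb : 0 < b) {f : (Fin n → Bool) → ℝ} (hf1 : cubeExpect f = 1) :
    ¬ HasNonnegFactorization (ipPatternMatrix b f) 0 := by
  rintro ⟨U, V, -, -, hM⟩
  have hz : ∀ z, f z = 0 := by
    intro z
    obtain ⟨x, y, hxy⟩ := exists_ipMap_eq hb z
    have := hM x y
    simp only [Finset.univ_eq_empty, Finset.sum_empty] at this
    rw [← hxy]; exact this
  have : cubeExpect f = 0 := by simp [cubeExpect, hz]
  rw [this] at hf1; exact zero_ne_one hf1

/-! ### Proof of Theorem 1.10 (§4) from Theorem 2.11, for the literal gadget -/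

set_option maxHeartbeats 400000 in -- one long parameter-bookkeeping proof (≈ 60 numeric facts); 200k is marginal
/-- **The quantitative core of "Proof of Theorem 1.10":** for `n ≥ 2`, `b ≥ 1000 log₂ n`, `f ≥ 0` with
`E f = 1` and a size-`r ≥ 1` non-negative factorisation of `M_f^b`, Theorem 2.11 gives
`deg_+(f + 1/n) ≤ 4 · max(deg f, ⌈(80 log₂ r + 480)/b⌉)` (Lemma 2.3 at `t = 2 log₂ r + 16 d log₂ n + 8`,
`d = max(deg f, ⌈(80 log₂ r + 480)/b⌉)`, then Lemma 2.4 with the shift `1/(2n)`; the printed constants are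
`C ≥ max(16α_1, 1000)`, `d = max{⌈α_1 log R/b⌉, deg f}`). [cite: KothariMekaRaghavendra2017, Proof of Thm 1.10 (§4) with Lemma 2.3 (§4.1) and Lemma 2.4 (§4.2)] -/
theorem nonnegDegree_add_inv_le_of_factorization (h211 : KothariMekaRaghavendra2017_thm211)
    (hn : 2 ≤ n) (hb : 1000 * Real.logb 2 n ≤ b) {f : (Fin n → Bool) → ℝ} (hf0 : ∀ z, 0 ≤ f z)
    (hf1 : cubeExpect f = 1) {r : ℕ} (hr : 1 ≤ r) {U : (Fin n → Fin b → Bool) → Fin r → ℝ}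
    {V : Fin r → (Fin n → Fin b → Bool) → ℝ} (hU : ∀ x l, 0 ≤ U x l) (hV : ∀ l y, 0 ≤ V l y)
    (hM : ∀ x y, ipPatternMatrix b f x y = ∑ l, U x l * V l y) :
    nonnegDegree (fun z => f z + 1 / n) ≤ 4 * max (cubeDegree f) ⌈(80 * Real.logb 2 r + 480) / (b : ℝ)⌉₊ := by
  classical
  set ℓ : ℝ := Real.logb 2 n with hℓ
  set L : ℝ := Real.logb 2 r with hL
  set D := cubeDegree f with hD
  set d₀ := ⌈(80 * L + 480) / (b : ℝ)⌉₊ with hd₀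
  set d := max D d₀ with hd
  -- the trivial range `d > n`
  by_cases hdn : n < d
  · exact (nonnegDegree_le _).trans (by omega)
  have hdn' : d ≤ n := not_lt.1 hdn
  -- basic numerics
  have hn0 : (0 : ℝ) < n := by exact_mod_cast (by omega : 0 < n)
  have hn2 : (2 : ℝ) ≤ n := by exact_mod_cast hn
  have hℓ1 : 1 ≤ ℓ := by
    rw [hℓ, ← Real.logb_self_eq_one (b := 2) (by norm_num)]
    exact Real.logb_le_logb_of_le (by norm_num) (by norm_num) hn2
  have hb1000 : (1000 : ℝ) ≤ b := le_trans (by linarith) hb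
  have hbpos : 0 < b := by exact_mod_cast (show (0 : ℝ) < b by linarith)
  have hb2 : 2 ≤ b := by exact_mod_cast (show (2 : ℝ) ≤ b by linarith)
  have hr0 : (0 : ℝ) < r := by exact_mod_cast hr
  have hL0 : 0 ≤ L := Real.logb_nonneg (by norm_num) (by exact_mod_cast hr)
  have hd₀1 : 1 ≤ d₀ := by
    have : 0 < (80 * L + 480) / (b : ℝ) := by positivity
    exact Nat.ceil_pos.2 this
  have hd1 : 1 ≤ d := le_trans hd₀1 (le_max_right _ _)
  have hDd : D ≤ d := le_max_left _ _
  have hd₀d : d₀ ≤ d := le_max_right _ _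
  have hdpos : (0 : ℝ) < d := by exact_mod_cast (by omega : 0 < d)
  -- `2^b ≥ n^1000`
  set q : ℝ := (2 : ℝ) ^ b with hq
  have h2b : (n : ℝ) ^ 1000 ≤ q := by
    rw [hq, pow_eq_two_rpow_mul_logb hn0 1000, ← Real.rpow_natCast 2 b]
    exact Real.rpow_le_rpow_of_exponent_le (by norm_num) (by rw [← hℓ]; push_cast; linarith)
  have hqbig : (40 : ℝ) * n ≤ q := by
    have h999 : (40 : ℝ) ≤ (n : ℝ) ^ 999 :=
      le_trans (show (40 : ℝ) ≤ 2 ^ 999 from le_trans (by norm_num : (40 : ℝ) ≤ 2 ^ 6)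
        (pow_le_pow_right₀ (by norm_num) (by norm_num))) (pow_le_pow_left₀ (by norm_num) hn2 999)
    calc (40 : ℝ) * n ≤ (n : ℝ) ^ 999 * n := mul_le_mul_of_nonneg_right h999 hn0.le
      _ = (n : ℝ) ^ 1000 := by ring
      _ ≤ q := h2b
  set κ : ℝ := 1 / (q - 1) with hκ
  have hq1 : 1 < q - 1 := by nlinarith
  have hκ0 : 0 < κ := by rw [hκ]; exact div_pos one_pos (by linarith)
  have hκle : κ ≤ 2 / q := by
    rw [hκ, div_le_div_iff₀ (by linarith) (by linarith)]; linarith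
  have hu : (n : ℝ) * κ ≤ 1 / 10 := by
    calc (n : ℝ) * κ ≤ n * (2 / q) := mul_le_mul_of_nonneg_left hκle hn0.le
      _ = (2 * n) / q := by ring
      _ ≤ 1 / 10 := by rw [div_le_div_iff₀ (by linarith) (by norm_num)]; linarith
  have hκ1 : κ ≤ 1 := by
    have : 2 * κ ≤ n * κ := mul_le_mul_of_nonneg_right hn2 hκ0.le
    linarith
  -- `ε = 2^{−0.3 b}`, `θ = 2^{−0.8 b}`
  set ε : ℝ := (2 : ℝ) ^ (-(3 / 10 : ℝ) * b) with hε
  set θ : ℝ := (2 : ℝ) ^ (-(4 / 5 : ℝ) * b) with hθ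
  have hε0 : 0 < ε := Real.rpow_pos_of_pos (by norm_num) _
  have hθ0 : 0 < θ := Real.rpow_pos_of_pos (by norm_num) _
  have hθε : θ * θ * 2 ^ b ≤ ε ^ 2 := by
    apply le_of_eq
    rw [hθ, hε, ← Real.rpow_natCast 2 b, ← Real.rpow_add (by norm_num), ← Real.rpow_add (by norm_num),
      sq, ← Real.rpow_add (by norm_num)]
    ring_nf
  have hεn : ε ≤ 1 / (n : ℝ) ^ 300 := by
    have e1 : (n : ℝ) ^ 300 = (2 : ℝ) ^ (ℓ * (300 : ℕ)) := by
      rw [hℓ]; exact pow_eq_two_rpow_mul_logb hn0 300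
    rw [e1, one_div, ← Real.rpow_neg (by norm_num), hε]
    exact Real.rpow_le_rpow_of_exponent_le (by norm_num) (by push_cast; linarith)
  have hn300 : (1 : ℝ) ≤ (n : ℝ) ^ 300 := one_le_pow₀ (by linarith)
  have hε1 : ε ≤ 1 := le_trans hεn (by rw [div_le_one (by positivity)]; exact hn300)
  have hκε : κ ≤ ε := by
    calc κ ≤ 2 / q := hκle
      _ = (2 : ℝ) ^ (1 - (b : ℝ)) := by
          rw [hq, Real.rpow_sub (by norm_num), Real.rpow_one, Real.rpow_natCast]
      _ ≤ ε := by rw [hε]; exact Real.rpow_le_rpow_of_exponent_le (by norm_num) (by linarith)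
  -- Bernoulli-type bounds
  have hA : (1 + κ * ε) ^ n ≤ 10 / 9 := by
    have h0 : 0 ≤ κ * ε := by positivity
    have h1 : (n : ℝ) * (κ * ε) ≤ 1 / 10 := by
      calc (n : ℝ) * (κ * ε) = n * κ * ε := by ring
        _ ≤ n * κ * 1 := mul_le_mul_of_nonneg_left hε1 (by positivity)
        _ ≤ 1 / 10 := by linarith
    calc (1 + κ * ε) ^ n ≤ 1 / (1 - n * (κ * ε)) := one_add_pow_le_one_div h0 (by linarith)
      _ ≤ 10 / 9 := by rw [div_le_div_iff₀ (by linarith) (by norm_num)]; linarith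
  have hA1 : 1 ≤ (1 + κ * ε) ^ n := one_le_pow₀ (le_add_of_nonneg_right (by positivity))
  have hK : (1 + κ) ^ n ≤ 10 / 9 := by
    calc (1 + κ) ^ n ≤ 1 / (1 - n * κ) := one_add_pow_le_one_div hκ0.le (by linarith)
      _ ≤ 10 / 9 := by rw [div_le_div_iff₀ (by linarith) (by norm_num)]; linarith
  have hK1 : 1 ≤ (1 + κ) ^ n := one_le_pow₀ (by linarith)
  have hKm : 9 / 10 ≤ (1 - κ) ^ n := le_trans (by linarith) (one_sub_mul_le_one_sub_pow (by linarith))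
  have hK2 : 9 / 10 ≤ (1 - κ ^ 2) ^ n := by
    have h1 : κ ^ 2 ≤ κ := by rw [sq]; exact mul_le_of_le_one_left hκ0.le hκ1
    have h2 : (n : ℝ) * κ ^ 2 ≤ 1 / 10 := le_trans (mul_le_mul_of_nonneg_left h1 hn0.le) hu
    exact le_trans (by linarith) (one_sub_mul_le_one_sub_pow (x := κ ^ 2) (by linarith))
  have hτ : (1 + κ * ε) ^ n - 1 < 1 := by linarith
  -- `m ∈ [9/10, 10/9]`
  have hm_le : regMean b f ≤ 10 / 9 := by
    have := regMean_le (n := n) hbpos hf0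
    rw [hf1, mul_one] at this
    exact this.trans hK
  have hm_ge : 9 / 10 ≤ regMean b f := by
    have := le_regMean (n := n) hbpos hf0
    rw [hf1, mul_one] at this
    exact hKm.trans this
  have hm0 : 0 < regMean b f := by linarith
  -- the decomposition hypothesis at `t = 2L + 16 d ℓ + 8`
  set t : ℝ := 2 * L + 16 * d * ℓ + 8 with ht
  set δ₀ : ℝ := (2 : ℝ) ^ t * ((d : ℝ) * (2 : ℝ) ^ (-(1 / 20 : ℝ) * b)) ^ d with hδ₀
  have hδ₀0 : 0 ≤ δ₀ := by positivity
  have hdec : ∀ P Q : (Fin n → Fin b → Bool) → ℝ, (∀ x, 0 ≤ P x) → ∑ x, P x = 1 → (∀ y, 0 ≤ Q y) →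
      ∑ y, Q y = 1 → (∀ x y, ((2 : ℝ) ^ (b * n) * P x) * ((2 : ℝ) ^ (b * n) * Q y) ≤ (2 : ℝ) ^ t) →
      HasAlignedDecomposition θ θ d δ₀ P Q :=
    fun P Q hP0 hP1 hQ0 hQ1 hH => h211 n b t d P Q hP0 hP1 hQ0 hQ1 hH
  have hM' : ∀ x y, f (ipMap b x y) = ∑ l, U x l * V l y := hM
  -- Lemma 2.3 (literal gadget)
  have happ := isApproxConicalJunta_div_of_nonnegFactorization hb2 hθ0.le hε0.le hθε hδ₀0 hdec hf0 hM'
    hU hV hm0 (κ := κ) (by rw [hκ, hq]) hτ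
  -- `ε' < 1/n⁴`
  have hε' : (κ + ε) * (1 + κ * ε) ^ n / (1 - ((1 + κ * ε) ^ n - 1)) < 1 / (n : ℝ) ^ 4 := by
    have h1 : (κ + ε) * (1 + κ * ε) ^ n / (1 - ((1 + κ * ε) ^ n - 1)) ≤ 5 / 2 * ε := by
      rw [div_le_iff₀ (by linarith)]
      have h3 : (κ + ε) * (1 + κ * ε) ^ n ≤ (2 * ε) * (10 / 9) :=
        mul_le_mul (by linarith) hA (by positivity) (by positivity)
      have h4 : ε * (1 + κ * ε) ^ n ≤ ε * (10 / 9) := mul_le_mul_of_nonneg_left hA hε0.le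
      have e : 5 / 2 * ε * (1 - ((1 + κ * ε) ^ n - 1)) = 5 * ε - 5 / 2 * (ε * (1 + κ * ε) ^ n) := by ring
      rw [e]; linarith
    have h2 : 5 / 2 * ε < 1 / (n : ℝ) ^ 4 := by
      have h296 : (4 : ℝ) ≤ (n : ℝ) ^ 296 :=
        le_trans (show (4 : ℝ) ≤ 2 ^ 296 from le_trans (by norm_num : (4 : ℝ) ≤ 2 ^ 2)
          (pow_le_pow_right₀ (by norm_num) (by norm_num))) (pow_le_pow_left₀ (by norm_num) hn2 296)
      have hn4 : 0 < (n : ℝ) ^ 4 := by positivity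
      have h5 := mul_le_mul_of_nonneg_left h296 hn4.le
      calc 5 / 2 * ε ≤ 5 / 2 * (1 / (n : ℝ) ^ 300) := by linarith
        _ < 1 / (n : ℝ) ^ 4 := by
            rw [show (n : ℝ) ^ 300 = (n : ℝ) ^ 4 * (n : ℝ) ^ 296 by ring]
            rw [mul_one_div, div_lt_div_iff₀ (by positivity) hn4]
            linarith
    exact lt_of_le_of_lt h1 h2
  have hε'0 : 0 ≤ (κ + ε) * (1 + κ * ε) ^ n / (1 - ((1 + κ * ε) ^ n - 1)) := by
    apply div_nonneg (by positivity); linarith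
  -- `2^{−t/2} = 1/(16 r n^{8d})`
  have h2t : (2 : ℝ) ^ (-t / 2) = 1 / ((r : ℝ) * (n : ℝ) ^ (8 * d) * 16) := by
    have e : -t / 2 = -(L + ℓ * ((8 * d : ℕ) : ℝ) + ((4 : ℕ) : ℝ)) := by rw [ht]; push_cast; ring
    rw [e, Real.rpow_neg (by norm_num), Real.rpow_add (by norm_num), Real.rpow_add (by norm_num), hL,
      Real.rpow_logb (by norm_num) (by norm_num) hr0, ← pow_eq_two_rpow_mul_logb hn0 (8 * d),
      Real.rpow_natCast, one_div]
    norm_num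
  have hΓ : (2 : ℝ) ^ b / (2 ^ b - 1) = 1 + κ := by
    rw [hκ, ← hq]
    field_simp
    ring
  -- `δ₀ ≤ 1/(16 n^{8d})`
  have hδ₀le : δ₀ ≤ 1 / (16 * (n : ℝ) ^ (8 * d)) := by
    have hlogd : Real.logb 2 d ≤ ℓ :=
      Real.logb_le_logb_of_le (by norm_num) hdpos (by exact_mod_cast hdn')
    have hlogd0 : 0 ≤ Real.logb 2 d := Real.logb_nonneg (by norm_num) (by exact_mod_cast hd1)
    have hbd₀ : 80 * L + 480 ≤ (b : ℝ) * d₀ := by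
      have := Nat.le_ceil ((80 * L + 480) / (b : ℝ))
      rw [← hd₀, div_le_iff₀ (by exact_mod_cast hbpos)] at this
      linarith
    have hd₀d' : (d₀ : ℝ) ≤ d := by exact_mod_cast hd₀d
    have hbd : 80 * L + 480 ≤ (b : ℝ) * d :=
      hbd₀.trans (mul_le_mul_of_nonneg_left hd₀d' (by positivity))
    have hbd' : 1000 * ℓ * d ≤ (b : ℝ) * d := mul_le_mul_of_nonneg_right hb hdpos.le
    have hdl : (d : ℝ) * Real.logb 2 d ≤ d * ℓ := mul_le_mul_of_nonneg_left hlogd hdpos.le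
    -- both sides as powers of two
    have lhs : δ₀ = (2 : ℝ) ^ (t + Real.logb 2 d * d + (-(1 / 20 : ℝ) * b) * d) := by
      rw [hδ₀, mul_pow, pow_eq_two_rpow_mul_logb hdpos d, ← Real.rpow_mul_natCast (by norm_num),
        ← Real.rpow_add (by norm_num), ← Real.rpow_add (by norm_num)]
      congr 1; ring
    have rhs : 1 / (16 * (n : ℝ) ^ (8 * d)) = (2 : ℝ) ^ (-(((4 : ℕ) : ℝ) + ℓ * ((8 * d : ℕ) : ℝ))) := by
      rw [Real.rpow_neg (by norm_num), Real.rpow_add (by norm_num), Real.rpow_natCast,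
        ← pow_eq_two_rpow_mul_logb hn0 (8 * d), one_div]
      norm_num
    rw [lhs, rhs]
    refine Real.rpow_le_rpow_of_exponent_le (by norm_num) ?_
    push_cast
    rw [ht]
    linarith
  -- `δ_F < 1/n^{8d}`
  have hn8d : 0 < (n : ℝ) ^ (8 * d) := by positivity
  have hδF : (1 + κ) ^ n * (δ₀ + r * (((2 : ℝ) ^ b / (2 ^ b - 1)) ^ n * (2 : ℝ) ^ (-t / 2))) <
      1 / (n : ℝ) ^ (8 * d) := by
    rw [hΓ, h2t]
    have e1 : (r : ℝ) * ((1 + κ) ^ n * (1 / ((r : ℝ) * (n : ℝ) ^ (8 * d) * 16))) =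
        (1 + κ) ^ n * (1 / (16 * (n : ℝ) ^ (8 * d))) := by
      field_simp
    rw [e1]
    have hw0 : 0 < 1 / (16 * (n : ℝ) ^ (8 * d)) := by positivity
    have hw16 : 1 / (n : ℝ) ^ (8 * d) = 16 * (1 / (16 * (n : ℝ) ^ (8 * d))) := by field_simp
    rw [hw16]
    calc (1 + κ) ^ n * (δ₀ + (1 + κ) ^ n * (1 / (16 * (n : ℝ) ^ (8 * d))))
        ≤ (10 / 9) * (1 / (16 * (n : ℝ) ^ (8 * d)) + (10 / 9) * (1 / (16 * (n : ℝ) ^ (8 * d)))) := by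
          refine mul_le_mul hK (add_le_add hδ₀le (mul_le_mul_of_nonneg_right hK hw0.le)) ?_ (by norm_num)
          positivity
      _ < 16 * (1 / (16 * (n : ℝ) ^ (8 * d))) := by linarith
  -- `Λ ∈ (0, 2]`
  obtain ⟨Λ, hΛ⟩ : ∃ Λ : ℝ, Λ = regMean b f * (1 + ((1 + κ * ε) ^ n - 1)) / (1 - κ ^ 2) ^ n := ⟨_, rfl⟩
  rw [← hΛ] at happ
  have hΛ0 : 0 < Λ := by rw [hΛ]; apply div_pos (mul_pos hm0 (by linarith)) (by linarith)
  have hΛ2 : Λ ≤ 2 := by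
    rw [hΛ, div_le_iff₀ (by linarith)]
    have : regMean b f * (1 + ((1 + κ * ε) ^ n - 1)) ≤ (10 / 9) * (10 / 9) := by
      refine mul_le_mul hm_le (by linarith) (by linarith) (by norm_num)
    linarith
  -- degree
  have hdegF : HasDegreeLE d (fun z => f z / Λ) := by
    have : (fun z => f z / Λ) = fun z => Λ⁻¹ * f z := funext fun z => by rw [div_eq_inv_mul]
    rw [this]
    exact ((hasDegreeLE_cubeDegree f).mono hDd).const_mul _
  have hF0 : ∀ z, 0 ≤ f z / Λ := fun z => div_nonneg (hf0 z) hΛ0.le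
  -- Lemma 2.4 with the shift `1/(2n)`
  have hconj : IsConicalJunta (4 * d) (fun z => f z + 1 / n) := by
    rcases le_or_gt 1 Λ with hΛ1 | hΛ1
    · -- `Λ ≥ 1`: `f + 1/n = Λ·(f/Λ + 1/(Λ n))`, `1/(Λn) ≥ 1/(2n)`
      have hη : 1 / (2 * (n : ℝ)) ≤ 1 / (Λ * n) := by
        apply one_div_le_one_div_of_le (by positivity)
        exact mul_le_mul_of_nonneg_right hΛ2 hn0.le
      have h := isConicalJunta_add_of_isApproxConicalJunta hF0 happ hε'0 hε' hdegF hδF hη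
      have h' := h.smul hΛ0.le
      convert h' using 1
      funext z
      field_simp
    · -- `Λ < 1`: `f = Λ·(f/Λ)` is itself an approximate junta; shift `1/n ≥ 1/(2n)`
      have happ' := happ.smul hΛ0.le hΛ1.le
      have e : (fun z => Λ * (f z / Λ)) = f := funext fun z => by field_simp
      rw [e] at happ'
      have hη : 1 / (2 * (n : ℝ)) ≤ 1 / n := by
        apply one_div_le_one_div_of_le hn0; linarith
      exact isConicalJunta_add_of_isApproxConicalJunta hf0 happ' hε'0 hε'
        ((hasDegreeLE_cubeDegree f).mono hDd) hδF hη
  exact (isConicalJunta_iff_nonnegDegree_le fun z => add_nonneg (hf0 z) (by positivity)).1 hconj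

/-- **Kothari–Meka–Raghavendra 2017, Theorem 1.10, from Theorem 2.11 — PROVED** (for the tree's literal
gadget `ipGadget`, with `c = 1/2000`, `C = 1000`): the typed statement `KothariMekaRaghavendra2017_thm110`
follows from the typed decomposition theorem `KothariMekaRaghavendra2017_thm211`. Assembly as printed
("Proof of Theorem 1.10", §4): Lemma 2.3 + Lemma 2.4 and the final count
`R ≥ 2^{Ω(b)(deg_+(f+1/n) − 8 deg f)}`; degenerate cases (`n = 1`, `r = 0`, `deg f = 0`) settled directly.
[cite: KothariMekaRaghavendra2017, Thm 1.10 with "Proof of Theorem 1.10" (§4), Lemma 2.3 (§4.1), Lemma 2.4 (§4.2), Thm 2.11 (§2.3)] -/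
theorem KothariMekaRaghavendra2017_thm110_of_thm211 (h211 : KothariMekaRaghavendra2017_thm211) :
    KothariMekaRaghavendra2017_thm110 := by
  classical
  refine ⟨1 / 2000, 1000, by norm_num, by norm_num, ?_⟩
  intro n hn f hf0 hf1 η hη b hb hCb r hr hfac
  have hn0 : (0 : ℝ) < n := by exact_mod_cast (by omega : 0 < n)
  have hbpos : 0 < b := by omega
  have hη0 : 0 ≤ η := le_trans (by positivity) hη
  -- `r ≥ 1`
  rcases Nat.eq_zero_or_pos r with hr0 | hrpos
  · subst hr0; exact not_hasNonnegFactorization_zero hbpos hf1 hfac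
  obtain ⟨U, V, hU, hV, hM⟩ := hfac
  set D := cubeDegree f with hD
  set Dp := nonnegDegree (fun x => f x + η) with hDp
  set L := Real.logb 2 r with hL
  have hr0' : (0 : ℝ) < r := by exact_mod_cast hrpos
  have hL0 : 0 ≤ L := Real.logb_nonneg (by norm_num) (by exact_mod_cast hrpos)
  have hb0 : (0 : ℝ) < b := by exact_mod_cast hbpos
  -- `L < c b (D₊ − 8D)`
  have hLX : L < 1 / 2000 * b * ((Dp : ℝ) - 8 * (D : ℝ)) :=
    (Real.logb_lt_iff_lt_rpow (by norm_num) hr0').2 hr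
  have hX0 : 0 < (Dp : ℝ) - 8 * (D : ℝ) := by
    by_contra hX
    have : 1 / 2000 * (b : ℝ) * ((Dp : ℝ) - 8 * (D : ℝ)) ≤ 0 :=
      mul_nonpos_of_nonneg_of_nonpos (by positivity) (not_lt.1 hX)
    linarith
  have hDpD : 8 * D + 1 ≤ Dp := by
    have : (8 * D : ℝ) < Dp := by linarith
    exact_mod_cast this
  -- `D₊ ≤ deg_+(f + 1/n)` (monotonicity in the shift)
  have hDp_le : Dp ≤ nonnegDegree (fun x => f x + 1 / n) := by
    have h1 := isConicalJunta_nonnegDegree (f := fun x => f x + 1 / n)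
      (fun x => add_nonneg (hf0 x) (by positivity))
    have h2 := h1.add_const (a := η - 1 / n) (by linarith)
    have e : (fun x => f x + 1 / (n : ℝ) + (η - 1 / n)) = fun x => f x + η := funext fun x => by ring
    rw [e] at h2
    exact (isConicalJunta_iff_nonnegDegree_le fun x => add_nonneg (hf0 x) hη0).1 h2
  rcases (show n = 1 ∨ 2 ≤ n by omega) with hn1 | hn2
  · -- `n = 1`: `D₊ ≤ 1` forces `D = 0`, hence `D₊ = 0`
    have hDpn : Dp ≤ n := nonnegDegree_le _
    have hD0 : D = 0 := by omega
    have := nonnegDegree_add_eq_zero_of_cubeDegree_eq_zero hf0 hD0 hη0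
    omega
  · -- main case
    have hCb' : 1000 * Real.logb 2 n ≤ b := hCb
    have hmain := nonnegDegree_add_inv_le_of_factorization h211 hn2 hCb' hf0 hf1 hrpos hU hV hM
    set d₀ := ⌈(80 * L + 480) / (b : ℝ)⌉₊ with hd₀
    have hle : Dp ≤ 4 * max D d₀ := hDp_le.trans hmain
    rcases le_or_gt d₀ D with h1 | h1
    · rw [max_eq_left h1] at hle; omega
    · rw [max_eq_right h1.le] at hle
      have hn2' : (2 : ℝ) ≤ n := by exact_mod_cast hn2
      have hℓ1 : 1 ≤ Real.logb 2 n := by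
        rw [← Real.logb_self_eq_one (b := 2) (by norm_num)]
        exact Real.logb_le_logb_of_le (by norm_num) (by norm_num) hn2'
      have hb1000 : (1000 : ℝ) ≤ b := le_trans (by linarith) hCb'
      have hd₀lt : (d₀ : ℝ) < (80 * L + 480) / b + 1 := Nat.ceil_lt_add_one (by positivity)
      rcases (show d₀ = 1 ∨ 2 ≤ d₀ by omega) with hd1 | hd2
      · have hD0 : D = 0 := by omega
        have := nonnegDegree_add_eq_zero_of_cubeDegree_eq_zero hf0 hD0 hη0
        omega
      · have h2 : (2 : ℝ) ≤ d₀ := by exact_mod_cast hd2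
        have hDp4 : (Dp : ℝ) ≤ 4 * d₀ := by exact_mod_cast hle
        have e1 : (d₀ : ℝ) * b < 80 * L + 480 + b := by
          have := mul_lt_mul_of_pos_right hd₀lt hb0
          rwa [add_mul, one_mul, div_mul_cancel₀ _ hb0.ne'] at this
        -- `b < 80L + 480`, hence `0.52 b < 80 L`
        have e0 : 2 * (b : ℝ) ≤ (d₀ : ℝ) * b := mul_le_mul_of_nonneg_right h2 hb0.le
        have e2 : (b : ℝ) < 80 * L + 480 := by linarith
        have e3 : (52 : ℝ) * b < 8000 * L := by linarith
        -- `X b ≤ D₊ b ≤ 4 d₀ b < 320 L + 1920 + 4b`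
        have e4 : (Dp : ℝ) * b ≤ 4 * (d₀ : ℝ) * b := mul_le_mul_of_nonneg_right hDp4 hb0.le
        have e5 : (0 : ℝ) ≤ (D : ℝ) * b := by positivity
        have e6 : 1 / 2000 * (b : ℝ) * ((Dp : ℝ) - 8 * (D : ℝ)) =
            1 / 2000 * ((Dp : ℝ) * b) - 8 / 2000 * ((D : ℝ) * b) := by ring
        rw [e6] at hLX
        linarith

end Literature.Combinatorics.Optimization

end
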